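import Summits.NavierStokesRegularity.NavierStokesRegularity.Theses.AdaptedFrequency
import Literature.Analysis.FluidPDE.AdaptedBackwardKernel
import Literature.Analysis.UnboundedOperators.HeatKernelGradient
import Literature.Analysis.FluidPDE.PineauVicolRSS
import Literature.Analysis.FluidPDE.HyperbolicDSSOrbit

/-!
# Disproof of `FrequencyRigidity` (crux `stmt-NavierStokesRegularity-2955`, route `AdaptedFrequency`) — findings

Standing adversary file (refuter, cdisprove mode).  Prose lives in docstrings; every claim below
is a checked theorem (this file has no `sorry`).

LANDED through the gate (importable; namespace
`Summit.NavierStokesRegularity.NavierStokesRegularity.Theorems.FrequencyRigidity.Negative`):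
* `…/Theorems/FrequencyRigidity/Negative/Clauses.lean` (p73251) — clause bundles,
  `frequencyRigidity_iff`, `kernelClauses_backwardHeatKernel`, all objects/variants, (A);
* `…/Negative/FrequencyStructure.lean` (p74582) — (T);
* `…/Negative/RigidRotation.lean` (p74300) — (B);
* `…/Negative/SelfSimilarSwirl.lean` (p75287) — (C);
* `…/Negative/SmallLocalTypeI.lean` (p75878) — (B′);
* series (R) `…/Negative/BreathingSwirlObjects.lean` (p81636, LANDED) |
  `BreathingSwirl|BreathingSwirlNonRigid|BreathingSwirlNormalForm.lean` (gen 2; proposals in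
  flight at the time of writing — see the crux item's `served_by`) — (R1)–(R3) below.
OTHER SEATS' negative-side files this one cites (line `two-ended-pinning`, refuter drefute g2):
* `…/Negative/TwoEndedPinningStubs.lean` — verbatim copies of the line's vocabulary
  (`ScaleInvariantBounds`, `firstVariationDensity`, `IsFlatInhabitant`); the one-clause mutations
  (vii) `0 < A` and (viii) flatness are inhabited by the ZERO flow;
* `…/Negative/LinearStrainFlow.lean` — the exact linear strain–rotation NS flow
  `v = (2t)⁻¹(x₁,x₂,−2x₃) + (c/(−t))(−x₂,x₁,0)`: classical NS for every `ν`, `curl v ≡ (2c/(−t))e₃`,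
  `H = 4c²(−t)⁻²` EXACTLY against any unit-mass weight, scale-invariant bounds and the
  transport-free first variation (ix) hold — `IsFlatInhabitant` minus {(iii) global sup bound,
  (v.3) adjoint equation} is inhabited by honest NS dynamics (vortex stretching at the critical
  axial rate).  See "Targets (v2)" below for the general linear no-go that complements it.
This work-file keeps a self-contained copy (namespace `…Cruxes.FrequencyRigidity.Disproof`) so
that it elaborates independently of the landing order.  GEN-2 ADDITIONS (2026-08-16, refuter
`…-2955-g2-0`; header v6.2): section (R) "constant frequency is NOT rigidity" (the breathing two-shell swirl)
and section "Targets" (analysis of the 15 registered stubs of the three lines).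

## Verdict so far: NO KILL.  Why the crux resists

`FrequencyRigidity = ¬ ∃ (ν C Λ₀ v q K), …` asks for a smooth ancient Navier–Stokes flow on
`ℝ³ × (−∞,0)` with the GLOBAL Type-I bound `‖v(t,x)‖ ≤ C/√(−t)` (both ends: blow-up rate at
`t ↑ 0`, decay at `t → −∞`), an adapted Gaussian-comparable kernel `K` at `(0,0)`, positive adapted
enstrophy `H` and constant adapted frequency `Λ ≡ Λ₀`.  Any witness must have `curl v(t) ≢ 0` for
every `t < 0`.  A spatially bounded classical solution is mild up to a Galilean wobble
`b(t) + w(x − B(t), t)` (KNSS, arXiv:0709.3599 §3 Lemma 3.1: a bounded weak solution is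
`mild + caloric + b(t)`; the "parasitic solutions" `u = b(t)`, `p = −b′(t)·x` of their p. 3), so a
witness contains a NON-TRIVIAL BOUNDED MILD ANCIENT solution with Type-I decay at both ends — an
object whose existence is open (it is excluded by the KNSS Liouville conjecture, ibid. p. 3: "any
ancient mild solution with bounded velocity is constant … open even in the steady-state case" =
(L) = `stmt-NavierStokesRegularity-0057`, and for small `C` by the gap argument `M ≤ c κ M²`,
`M = sup √(−t)‖w(t)‖∞`).  Conversely (L) implies the crux WITHOUT using the frequency clause at
all.  The route's endgame IS in print for bounded profiles: Tsai 1998 (ARMA 143) Thm 1, p. 31 —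
"If a weak solution `U` of (1.3) belongs to `L^q(ℝ³)` for some `q ∈ (3, ∞]`, then it must be
constant (and hence identically zero if `q < ∞`)"; his Remark 5.4 (`U = ∇Φ`, `Φ` harmonic: non-trivial
IRROTATIONAL self-similar solutions) is excluded here by `H > 0`.  Hence: no unconditional counterexample is constructible today, and no
formal loophole was found (readback in the session NOTES: `Laplacian.laplacian` is Mathlib's
function Laplacian, `deriv`/Bochner junk only bites where `H = 0`, which the clause `0 < H t`
excludes).

## What IS proved here (load-bearing analysis, all with `K` = backward heat kernel at `(0,0)`)

* `frequencyRigidity_iff` — the crux regrouped into named clause bundles (pure bookkeeping).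
* (A) `frequencyRigidity_false_without_posH` — drop `0 < H t`: the zero flow is a witness
  (`Λ₀ = 0`).  Any proof must use positivity of the adapted enstrophy.
* (B) `frequencyRigidity_false_without_typeI` and the sharper
  `frequencyRigidity_false_with_local_typeI` — drop the Type-I bound, or impose it only on the
  unit parabolic cylinder `Q₁ = (−1,0) × B₁`: RIGID ROTATION `v = e₃ × x`,
  `q = (‖x‖² − x₃²)/2` is a smooth ancient NS flow, the backward heat kernel is adapted to it
  (the flow is tangent to spheres about the pole), `curl v ≡ 2e₃`, `H ≡ 4`, `Λ ≡ 0 = Λ₀`.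
  So the GLOBAL (spatially uniform) sup bound is load-bearing: a "local Type-I at the singular
  point" restatement of the crux would be FALSE.  (B′) `frequencyRigidity_false_with_local_typeI_small`:
  slow rotation `Ω e₃ × x` does it with local constant `C = |Ω|` as small as desired — whereas the
  GLOBAL crux is TRUE for small `C` (gap below), so the global/local distinction is substantive.
* (C) `frequencyRigidity_false_without_momentum` — keep joint smoothness, incompressibility and
  the global Type-I bound but drop the momentum equation: the backward SELF-SIMILAR Gaussian swirl
  `v(t,x) = (−t)⁻¹ e^{−‖x‖²/(−t)} e₃ × x` has the heat kernel as adapted kernel,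
  `H(t) = A(−t)^{−2}`, `Λ ≡ 2`.  So the equality case `Λ₀ = 2` IS realised kinematically and only
  the Navier–Stokes dynamics (NRŠ/Tsai self-similar Liouville) can exclude it: the endgame is
  load-bearing, and `Λ₀ = 2` is the value a prover's equality-case analysis must confront.

* (T) `FreqClause.differentiableAt`, `FreqClause.power_law`, `FreqClause.exponent_eq_two` —
  STRUCTURE of the frequency clause: `Λ₀ ≠ 0` forces differentiability of `H` (else `deriv` junk
  gives `Λ = 0`); constant frequency ⇔ exact power law `H(t) = H(−1)(−t)^{−Λ₀}`; and under the
  two-ended enstrophy bound `H(t) ≤ M(−t)^{−2}` (for an honest ancient Type-I flow a consequence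
  of the scale-invariant gradient estimate `|∇v(t)| ≲ (−t)^{−1}` and `∫K = 1`) the exponent is
  PINNED: `Λ₀ = 2`.  So a counterexample must have `H(t) = A(−t)^{−2}` on the nose — the exact
  backward-self-similar enstrophy law (on a `λ`-DSS flow `(−t)²H(t)` is `log λ`-periodic and only
  exceptionally constant) — and a prover may reduce to the equality case `Λ₀ = 2`.
  (Caveat recorded: for `Λ₀ = 0` the clause alone does not force `H` constant — a singular
  monotone `H` has `deriv H ≡ 0` — but `H` of a smooth flow is smooth, so this is not exploitable.)

* (R) **Constant frequency is NOT rigidity** (gen 2; objects `ψ`, `V₂`, `Wb`, `breath`, …, end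
  of file).  The BREATHING TWO-SHELL SWIRL `breath ν t x = (−t)^{−1/2} W_t(x/√(−t))`,
  `W_t = a(t)V + b(t)V₂`, `a = √A₂ cos log(−t)`, `b = √A₁ sin log(−t)`, `V = χ·(e₃×·)` (inner
  ball), `V₂ = ψ·(e₃×·)` (outer shell `3 ≤ ‖y‖² ≤ 8`, DISJOINT support), `Aᵢ` the two Gaussian
  profile enstrophies: smooth, divergence-free, GLOBAL Type-I, heat kernel adapted, and
  `H(t) = A₁A₂/t²` EXACTLY (`adaptedEnstrophy_breath`; disjoint supports + `cos² + sin² = 1`),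
  so `Λ ≡ 2` (`freqClause_breath`) — yet (R1) `breath_not_selfSimilar` (the half-turn dilation
  `l = e^{π/2}` FLIPS the field; the full turn `e^{π}` is a symmetry: `breath_dss`, a λ-DSS field
  with exactly flat `t²H`), (R2) `breath_not_rotatingWave` (not `pvAnsatz α U₀` for ANY `α`, `U₀`),
  (R3) `kinematic_canonical_witness`: with the heat kernel it is CENTRED (`∫xK = ∫vK = 0`), has
  scale-invariant bounds `‖∇v‖,‖curl v‖ ≤ C′/(−t)`, `‖∂ₜv‖ ≤ C′(−t)^{−3/2}`, a kernel STEADY in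
  similarity variables, symmetry-covariant and slaved (trivially) — EVERY clause of line
  kernel-fading-memory's `IsCanonicalWitness` except `ns` and `unique`.  MESSAGE: the inference
  "Λ ≡ const (= equality case of log-convexity) ⇒ ∂_σω̃ ∥ ω̃ ⇒ self-similar mod wobble" of the
  crux docstring is false short of the momentum equation (here `∂_σω̃ ⊥ ω̃`, centred gauge, no
  wobble); the lines' normalisations (centring, pinning, flatness, kernel steadiness / covariance
  / slaving) exclude nothing by themselves; slaving has no converse (unsteady flow, steady
  kernel); `Λ` alone cannot detect DSS.  All rigidity must come from NS (head law, torque law,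
  Liouville theorems).  CAVEAT / HINT: every explicit example of this file ((B), (C), (R)) is
  TOROIDAL (`⟪x, v⟫ = 0`) — the only class with an explicit adapted kernel, since the backward heat
  kernel is adapted to `v` iff `v ⊥ x`, and for any other divergence-free drift the Gaussian is
  not invariant in similarity variables (`νΔγ + div((U + ½y)γ) = U·∇γ`).  NS is reported to
  be very restrictive on toroidal Type-I ancient flows (all three triagers of card
  `radial-vorticity-antidynamo` grade that class as already excluded by 2D-type / rigid-rotation
  arguments — not re-verified here), so a prover may legitimately look for a rigidity mechanism
  that USES the poloidal part, i.e. the genuinely drift-dependent (non-Gaussian) kernel —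
  (R) only certifies that nothing toroidal-blind (kernel calculus + `Λ ≡ const` + normal form) can
  work.

* (W) **THE WALL, as a checked implication** (gen 2 cycle 2; file `…/Negative/RSSWall.lean`,
  proposal in flight at the time of writing; NOT copied here — it needs the Pineau–Vicol
  similarity-variable files): `rssLiouvilleBounded_of_frequencyRigidity :
  CoRotatingKernelHypothesis α → FrequencyRigidity → RSSLiouvilleBounded α` for EVERY angular
  speed `α`, where `RSSLiouvilleBounded α` says that a smooth profile `U` with `U`, `DU` bounded
  whose rotated-self-similar field `rss α U = pvAnsatz α U` (`(−t)^{−1/2}R(αs)U(R(−αs)x/√(−t))`,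
  `s = −log(−t)`) is a classical NS flow on `(−∞,0)` is irrotational, and the hypothesis H says
  such a flow admits an adapted Gaussian-comparable kernel of CO-ROTATING self-similar form
  `K(t,x) = (−t)^{−3/2}𝒦(R(−αs)x/√(−t))` (the invariant density of the Ornstein–Uhlenbeck drift
  `−½z` perturbed by `−U` and the rotation `αJz`; standard in invariant-measure theory, not in the
  tree, hence carried as a hypothesis; CONSISTENT: on the toroidal class the heat kernel is one,
  `coRotatingKernel_of_tangent`).  Mechanism: with a co-rotating kernel `H(t) = A(−t)^{−2}`
  EXACTLY, `A = ∫‖curl U‖²𝒦` (`adaptedEnstrophy_rss`) — the frequency functional cannot see `α` —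
  so `A > 0` inhabits the crux's `∃` and `A = 0` forces `curl U ≡ 0`.  Anchor:
  `rssLiouvilleBounded_zero` (`α = 0`) is PROVED from the tree's Tsai theorem
  (`tsai_selfsimilar_bounded_holds`, via `lerayOrbit`), so the wall is exactly `α ≠ 0`:
  Pineau–Vicol 2026 Conj. 1.1 (= Bradshaw–Tsai OP 5.2) in the bounded-gradient class, open on the
  window `α ≈ 1`.  CONSEQUENCE: any proof of the crux, or of Stub 3 of the picked line, proves that
  conjecture for every `α` (modulo H); the lead's eventual `promote-stub` can cite the theorem.

## Targets — the 15 registered stubs of the three lines (gen 2; no kill; why)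

Lines: `two-ended-pinning` (stubs `scaleInvariantBounds`, `enstrophyFirstVariation`,
`flatEnstrophyLiouville`), `kernel-fading-memory` (`kernelCentring`, `witnessRegularity`,
`kernelMerging`, `kernelCovariance`, `kernelSlaving`, `noCanonicalWitness`; the REGISTERED
skeleton), `moving-adjoint-bernoulli` (`normalForm`, `movingAdjointBernoulli`, `scalingClosure`,
`rotatingWaveReduction`, `selfSimilarLeaf`, `rotatedLeaf`).
* CONDITIONAL ON A WITNESS (hypothesis `IsWitness` / `IsNormalForm` / `IsFlatInhabitant` / the
  `∃`-body): `kernelCentring`, `witnessRegularity`, `noCanonicalWitness`, `normalForm`,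
  `scalingClosure`, `rotatingWaveReduction`, `selfSimilarLeaf`, `rotatedLeaf`,
  `flatEnstrophyLiouville`.  If the crux is true these are VACUOUSLY true, so none can be refuted
  short of refuting the crux itself (= exhibiting a Type-I ancient NS flow with constant `Λ`,
  open).  What (R) adds: their non-NS content is nil — `kinematic_canonical_witness` meets every
  normal-form clause, so e.g. `rotatingWaveReduction` cannot be proved from flatness + centring +
  kernel structure; it needs the head law (S2) in an essential, instantaneous way.
* GENUINE (quantify over configurations that exist): `kernelMerging` (Harris mixing of the
  reversed-log-time Fokker–Planck flow, drift `U + ½y`, `‖U‖ ≤ C`), `kernelSlaving` (linear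
  response), `kernelCovariance` (pure kernel calculus + uniqueness), `scaleInvariantBounds` (KNSS),
  `enstrophyFirstVariation` and `movingAdjointBernoulli` (kernel pairings).  Cheap models tried:
  `v ≡ 0` (heat kernel unique by Widder; merging holds with the TRANSLATION rate
  `((−t₂)/(−t₁))^{1/2}` — two backward heat kernels with poles `(0,0)`, `(0,a)`,
  `|a| = 2√(ν(−t₂))`, both obey a fixed Gaussian upper bound on `[t₁,t₂]` and are at `L¹`-distance
  `≍ |a|/√(ν(−t₁))` at `t₁`: so NO merging exponent `κ > 1/2` is possible, the stub's `∃ κ` is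
  consistent only because it allows `κ ≤ 1/2`); the Galilei wobble `v = b(t)`, `|b| ≤ C/√(−t)`,
  `q = −⟪b′,x⟫` (NS, Type-I; adapted kernel = heat kernel translated along the backward
  characteristic, comparable since the displacement is `≤ 2C√(−t)`; `curl v = 0` so every
  frequency-side statement is trivial there); rigid rotation (excluded from the scale-invariant
  bounds, consistent with (B)); the breathing swirl (R) (slaving/covariance hold, steady kernel).
  No stub failed; `kernelSlaving`'s weight `(1+‖y‖²)²K̃` is what the two-sided comparability buys
  (`|∇log K̃| ≲ 1 + ‖y‖`), and short pulses of unsteadiness are excluded by the pointwise bound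
  `|∂ₛU| ≤ ½C + C′(1 + ½‖y‖)` implied by `HasScaleInvariantBounds` — both hypotheses are
  load-bearing for the stated form (drop either and a pulse / far-tail counterexample appears).
* Formal junk checked: all `∫ τ in Ioi 0, …` and `deriv` occurrences in `IsSlaved` are honest
  under the stubs' hypotheses (continuity + Gaussian tails ⇒ integrable; `K ∈ C²` ⇒ `simKernel`
  differentiable in `s`).

## Targets (v2) — the lead's reshaped skeleton of the PICKED line `two-ended-pinning` (6 stubs)

PICKED (2026-08-16): `two-ended-pinning`; registered stubs `stub_unitTimeDerivBounds` (1a, KNSS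
window bound at `t = −1`), `stub_scaleInvariantBounds_of_unitTime` (1b, rescaling transfer),
`stub_vorticitySqTransport` (2a, pointwise `(∂ₜ + v·∇ − νΔ)‖ω‖² = 2⟪ω,Dvω⟫ − 2ν|Dω|²_F`),
`stub_kernelPairing` (2b, `d/dt ∫φK = ∫(∂ₜφ + Dφ·v − νΔφ)K`), `stub_vorticitySqBounds` (2c),
`stub_flatEnstrophyLiouville` (3, `¬ IsFlatInhabitant`, held by the lead).  Exact-signature
readback of 1a–2c (this seat, gen 2 cycle 2): every object is honest Mathlib/tree vocabulary —
`IsClassicalNSSolutionOn` = joint `C^∞` on `Iio 0 ×ˢ univ` + pointwise momentum with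
`timeDerivWithin (Iio 0)` (= `deriv` on the open set) + `IsDivFree`; `IsAdaptedBackwardKernel` =
joint `C²` + positivity + adjoint clause + unit mass + concentration; `IsGaussianComparable` on
`Iio 0` about `(0,0)` reads `(0 − t)^{−3/2}`; `HasTypeITimeDecay C v = ∀ t<0 ∀ x, ‖v t x‖ ≤ C/√(−t)`;
`frobeniusNormSq` basis-free; `deriv (fun s => ‖curl (v s) x‖²) t` at `t < 0` is the honest
partial derivative (interior point of `Iio 0 ×ˢ univ`).  Quantifier order: 1a/1b have
`∀ C, ∃ C', ∀ (u,p)` — uniform constants, which is what KNSS §4 gives (constants depend on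
`(k, δ, sup|u|)` only; the tree's `KNSS2009_regularity_boundedWeak_window_holds` is a THEOREM with
standard axioms).  Degenerate instances: `C < 0` makes 1a/1b/2b/2c vacuous (fine), `C = 0` forces
`v ≡ 0` (bounds trivial); the Galilei wobble `v = b(t)` has `Dᵏv = 0` for `k ≥ 1` (1a only bounds
orders `≥ 1` — the parasitic solutions are invisible, as they must be); bounded potential flows
`∇h(t,·)`, `h` harmonic, are constant in `x` by Liouville, so no classical-but-not-mild flow escapes
1a.  2a is an algebraic identity behind the tree's vorticity equation; 2b is Friedman Ch.1 §8 kernel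
calculus whose `R → ∞` step uses exactly the Gaussian UPPER bound and `|v| ≤ C/√(−b)` on `[a,b]`
(both in the hypotheses); 2c is bookkeeping.  VERDICT: stubs 1a–2c are TRUE technical lemmas (no
junk, no missing side condition found); stub 3 is the crux in pinned normal form (vacuously true
if the crux holds; any inhabitant refutes the crux) — not attackable short of the open problem.
Single-clause mutation table of `IsFlatInhabitant` (nine clauses (i)–(ix)), collecting all seats:
(vii), (viii) ← zero flow (`TwoEndedPinningStubs`); {(ii),(ix)} ← kinematic swirl (C) and the
breathing swirl (R) (this file; (ix) fails for them because without the vorticity equation the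
transport identity 2a is unavailable); {(iii),(v.3)} ← linear strain flow (`LinearStrainFlow`);
(i) `0 < ν`: entangled with (v) — for `ν = 0` a transported density of a divergence-free flow has
constant sup norm and cannot be Gaussian-comparable (`sup K(t) ≍ (−t)^{−3/2}`), for `ν < 0` the
adjoint clause is backward-parabolic from the pole (no positive solution); (iv), (ix) are
consequences of the rest (stubs 1–2); (iii) ALONE, (v)/(vi) ALONE: no witness known (would be a
local-Type-I singular ancient NS flow with an adapted comparable kernel and flat `H`, resp. an
honest global-Type-I ancient flow — (L′)).
GENERAL LINEAR NO-GO (paper, extends `LinearStrainFlow`'s second-moment computation; recorded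
so that nobody searches this class again).  Let `v = M(t)x` be ANY linear NS flow that is
self-similar about `(0,0)`, `M(t) = M₀/(−t)`: NS ⇔ `tr M₀ = 0` and `M₀ + M₀²` symmetric ⇔
(writing `M₀ = S₀ + [w]ₓ`) `S₀ w = w` — the vorticity direction is an eigenvector of the strain
with eigenvalue exactly `1` (critical stretching), so on the plane `P = w^⊥` the matrix
`B := ½I + M₀` restricted to `P` has TRACE ZERO.  A positive solution `K` of the adjoint clause
with unit mass and finite second moments `Σ(τ) = ∫ x xᵀ K`, `τ = −t`, obeys (pairing rule with
`φ = xᵢxⱼ`) `Σ̇ = −(M₀Σ + ΣM₀ᵀ)/τ + 2νI`, i.e. `R(u) := Σ/τ`, `u = log τ`, solves the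
constant-coefficient ODE `R′ = −(BR + RBᵀ) + 2νI` and must stay `≽ 0` as `u → −∞` (concentration
at the pole).  On `P`: if `B_P` is elliptic (eigenvalues `±iθ`, rotation-dominated) it preserves a
positive form `T`, and `d/du ⟨R_P, T⟩ = 2ν tr T > 0` forces `⟨R_P, T⟩ → −∞` as `u → −∞`; if
hyperbolic (`±μ`), the compressive diagonal entry tends to `−ν/μ < 0`; if nilpotent, an entry is
`2νu + c → −∞`.  In every case positivity fails near the pole: NO self-similar linear NS flow with
`curl v ≠ 0` admits an adapted kernel with finite second moments (a fortiori no Gaussian-comparable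
one), whatever is done about the sup bound (iii).  (For `w = 0`, `M₀` symmetric, `curl v ≡ 0` and
`H ≡ 0`.)  The axisymmetric strain of `LinearStrainFlow` is the case `μ = θ = 0` on the symmetric
part (`m(τ) = τ(k + 4ν log τ)`).

## Quantitative remarks (not formalised)

* No SMALL witness: for a bounded mild ancient `w` with `M = sup_t √(−t)‖w(t)‖∞`, the Duhamel
  formula from `t₀ → −∞` gives `M ≤ κ ν^{−1/2} M²` (`∫_{−∞}^t (t−s)^{−1/2}(−s)^{−1} ds = π(−t)^{−1/2}`),
  so `M = 0` or `M ≥ √ν/κ`: the crux is TRUE for `C < ε₀√ν` (Leray-rate gap; cf. the tree's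
  `leray_blowup_rate`).  Any counterexample has Type-I constant above the gap.
* The crux follows from the KNSS Liouville conjecture (L) for bounded ancient mild solutions
  WITHOUT the frequency clause: on `(−∞,−1]` the flow is bounded, hence (mod wobble) constant,
  hence `curl v = 0` there, contradicting `H > 0`.

## Not testable in isolation (recorded, not formalised)

Dropping a KERNEL clause (C², positivity, adjoint equation, unit mass, concentration,
comparability) or the CONSTANCY of `Λ` leaves `NS ∧ global Type-I ∧ H > 0`, which already has no
known inhabitant (open Liouville problem above) — these hypotheses cannot be shown load-bearing
by a witness today.  Near-miss family (no decay at `t → −∞`): the Bessel vortex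
`v = e^{−νk²t} k⁻¹ J₁(k r) e_θ` is a bounded-near-0 ancient circular NS flow tangent to spheres,
so the heat kernel is adapted, `H(t) = I₀(2νk²(−t))`, and `Λ(t) = −2νk²(−t) I₁/I₀ ≠ const`:
dropping ONLY the `t → −∞` half of the Type-I bound is not killed by any explicit family we know.
-/

noncomputable section

set_option linter.dupNamespace false

namespace Summit.NavierStokesRegularity.NavierStokesRegularity.Cruxes.FrequencyRigidity.Disproof

open Literature.Analysis.FluidPDE Literature.Analysis.UnboundedOperators
open MeasureTheory Set Filter Topology Function
open scoped Laplacian InnerProductSpace RealInnerProductSpace ContDiff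

/-- Physical space `ℝ³`. -/
abbrev E3 := EuclideanSpace ℝ (Fin 3)

/-! ### The crux, regrouped into named clause bundles -/

/-- Global Type-I bound `‖v(t,x)‖ ≤ C/√(−t)` on `ℝ³ × (−∞,0)` (verbatim clause of the crux). -/
def TypeIBound (C : ℝ) (v : ℝ → E3 → E3) : Prop :=
  ∀ t ∈ Iio (0:ℝ), ∀ x, ‖v t x‖ ≤ C / Real.sqrt (-t)

/-- The five adapted-kernel clauses of the crux for the drift `v` (verbatim). -/
def KernelClauses (ν : ℝ) (v : ℝ → E3 → E3) (K : ℝ → E3 → ℝ) : Prop :=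
  ContDiffOn ℝ 2 (uncurry K) (Iio (0:ℝ) ×ˢ univ) ∧
  (∀ t ∈ Iio (0:ℝ), ∀ x, 0 < K t x) ∧
  (∀ t ∈ Iio (0:ℝ), ∀ x,
    timeDerivWithin (Iio (0:ℝ)) K t x + fderiv ℝ (K t) x (v t x) + ν * (Δ (K t)) x = 0) ∧
  (∀ t ∈ Iio (0:ℝ), ∫ x, K t x = 1) ∧
  (∀ φ : E3 → ℝ, Continuous φ → (∃ M : ℝ, ∀ x, |φ x| ≤ M) →
    Tendsto (fun t => ∫ x, φ x * K t x) (𝓝[Iio (0:ℝ)] (0:ℝ)) (𝓝 (φ (0 : E3))))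

/-- Two-sided Gaussian comparability about the pole `(0,0)` (verbatim clause of the crux). -/
def Comparable (K : ℝ → E3 → ℝ) : Prop :=
  ∃ c₁ c₂ C₁ C₂ : ℝ, 0 < c₁ ∧ 0 < c₂ ∧ 0 < C₁ ∧ 0 < C₂ ∧ ∀ t ∈ Iio (0:ℝ), ∀ x,
    c₁ * ((0:ℝ) - t) ^ (-(3:ℝ) / 2) * Real.exp (-(‖x - (0 : E3)‖ ^ 2) / (c₂ * ((0:ℝ) - t))) ≤
        K t x ∧
      K t x ≤ C₁ * ((0:ℝ) - t) ^ (-(3:ℝ) / 2) * Real.exp (-(‖x - (0 : E3)‖ ^ 2) / (C₂ * ((0:ℝ) - t)))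

/-- The frequency clause of the crux: positive adapted enstrophy AND constant adapted frequency
`Λ₀` (verbatim, with the `∀ H Λ, H = … → Λ = … →` binders). -/
def FreqClause (v : ℝ → E3 → E3) (K : ℝ → E3 → ℝ) (Λ₀ : ℝ) : Prop :=
  ∀ H Λ : ℝ → ℝ, H = (fun t => ∫ x, ‖curl (v t) x‖ ^ 2 * K t x) →
    Λ = (fun t => (0 - t) * deriv H t / H t) →
      (∀ t ∈ Iio (0:ℝ), 0 < H t) ∧ (∀ t ∈ Iio (0:ℝ), Λ t = Λ₀)

/-- The frequency clause WITHOUT positivity of `H` (only `Λ ≡ Λ₀`). -/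
def FreqClauseNoPos (v : ℝ → E3 → E3) (K : ℝ → E3 → ℝ) (Λ₀ : ℝ) : Prop :=
  ∀ H Λ : ℝ → ℝ, H = (fun t => ∫ x, ‖curl (v t) x‖ ^ 2 * K t x) →
    Λ = (fun t => (0 - t) * deriv H t / H t) → ∀ t ∈ Iio (0:ℝ), Λ t = Λ₀

/-- Bookkeeping: the crux is `¬ ∃` of the conjunction of the bundles above. -/
theorem frequencyRigidity_iff :
    Theses.AdaptedFrequency.FrequencyRigidity ↔
      ¬ ∃ (ν C Λ₀ : ℝ) (v : ℝ → E3 → E3) (q : ℝ → E3 → ℝ) (K : ℝ → E3 → ℝ), 0 < ν ∧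
        IsClassicalNSSolutionOn (Iio 0) ν 0 v q ∧ TypeIBound C v ∧ KernelClauses ν v K ∧
        Comparable K ∧ FreqClause v K Λ₀ := by
  simp only [Theses.AdaptedFrequency.FrequencyRigidity, TypeIBound, KernelClauses, Comparable,
    FreqClause, and_assoc]

/-! ### The model kernel: the backward heat kernel at the pole `(0,0)` -/

/-- The backward heat kernel with pole `(0,0)`, as a function of `x` (the shift by `0` removed). -/
theorem backwardHeatKernel_zero_eq (ν t : ℝ) :
    backwardHeatKernel ν 0 (0 : E3) t = heatKernel (ν * (0 - t)) := by
  funext x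
  simp [backwardHeatKernel]

/-- Gradient of the model kernel along a vector: `DK(t)(x) h = −(K/(2ν(−t))) ⟪x, h⟫`. -/
theorem fderiv_backwardHeatKernel_apply (ν t : ℝ) (x h : E3) :
    fderiv ℝ (backwardHeatKernel ν 0 (0 : E3) t) x h =
      -(heatKernel (ν * (0 - t)) x / (2 * (ν * (0 - t)))) * ⟪x, h⟫ := by
  rw [backwardHeatKernel_zero_eq, (hasFDerivAt_heatKernel (ν * (0 - t)) x).fderiv]
  simp

/-- **The heat kernel is adapted to every flow tangent to the spheres about the pole.**  If
`⟪x, v(t,x)⟫ = 0` for all `t < 0` and `x`, then the backward heat kernel at `(0,0)` satisfies the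
five kernel clauses of the crux for the drift `v` (the transport term `DK·v` vanishes because
`∇K ∥ x`). -/
theorem kernelClauses_backwardHeatKernel {ν : ℝ} (hν : 0 < ν) (v : ℝ → E3 → E3)
    (hv : ∀ t ∈ Iio (0:ℝ), ∀ x, ⟪x, v t x⟫ = 0) :
    KernelClauses ν v (backwardHeatKernel ν 0 (0 : E3)) := by
  have hK := isAdaptedBackwardKernel_backwardHeatKernel (E := E3) hν 0 0
  refine ⟨hK.contDiffOn, hK.pos, ?_, hK.integral_eq_one, hK.tendsto_integral_mul⟩
  intro t ht x
  have h0 := hK.adjoint_eq t ht x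
  simp only [Pi.zero_apply, map_zero, add_zero] at h0
  rw [fderiv_backwardHeatKernel_apply, hv t ht x, mul_zero, add_zero]
  exact h0

/-- The model kernel is two-sided Gaussian-comparable (with equality constants). -/
theorem comparable_backwardHeatKernel {ν : ℝ} (hν : 0 < ν) :
    Comparable (backwardHeatKernel ν 0 (0 : E3)) :=
  isGaussianComparable_iff_fin_three.1 (isGaussianComparable_backwardHeatKernel hν 0 0)

/-! ### Vector-calculus helpers -/

/-- The Laplacian of a continuous linear map vanishes. -/
theorem laplacian_clm (f : E3 →L[ℝ] E3) (x : E3) : (Δ (⇑f)) x = 0 := by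
  rw [InnerProductSpace.laplacian_eq_iteratedFDeriv_stdOrthonormalBasis]
  simp only [iteratedFDeriv_two_apply]
  have : fderiv ℝ (⇑f) = fun _ => f := funext fun _ => ContinuousLinearMap.fderiv f
  simp [this]

/-- The Laplacian of the zero field vanishes. -/
theorem laplacian_zero_fun (x : E3) : (Δ (fun _ : E3 => (0 : E3))) x = 0 := by
  rw [InnerProductSpace.laplacian_eq_iteratedFDeriv_stdOrthonormalBasis]
  simp

/-- The curl of a constant field vanishes. -/
theorem curl_const (c x : E3) : curl (fun _ => c) x = 0 := by
  simp [curl]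

/-! ### (A) Positivity of the adapted enstrophy is load-bearing -/

/-- The crux with the clause `∀ t < 0, 0 < H t` DROPPED (everything else verbatim). -/
def FrequencyRigidityWithoutPosH : Prop :=
  ¬ ∃ (ν C Λ₀ : ℝ) (v : ℝ → E3 → E3) (q : ℝ → E3 → ℝ) (K : ℝ → E3 → ℝ), 0 < ν ∧
    IsClassicalNSSolutionOn (Iio 0) ν 0 v q ∧ TypeIBound C v ∧ KernelClauses ν v K ∧
    Comparable K ∧ FreqClauseNoPos v K Λ₀

/-- The variant is a strengthening of the crux (fewer hypotheses under `¬ ∃`). -/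
theorem frequencyRigidity_of_withoutPosH (h : FrequencyRigidityWithoutPosH) :
    Theses.AdaptedFrequency.FrequencyRigidity := by
  rw [frequencyRigidity_iff]
  rintro ⟨ν, C, Λ₀, v, q, K, hν, hNS, hTI, hK, hC, hF⟩
  exact h ⟨ν, C, Λ₀, v, q, K, hν, hNS, hTI, hK, hC, fun H Λ hH hΛ => (hF H Λ hH hΛ).2⟩

/-- The zero flow is a classical NS solution on any time set. -/
theorem isClassicalNSSolutionOn_zero (S : Set ℝ) (ν : ℝ) :
    IsClassicalNSSolutionOn S ν (0 : ℝ → E3 → E3) (fun _ _ => (0 : E3)) (fun _ _ => (0 : ℝ)) where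
  smooth_velocity := contDiffOn_const
  smooth_pressure := contDiffOn_const
  momentum t ht x := by
    simp [timeDerivWithin_apply, convect_apply, laplacian_zero_fun]
  divFree t ht x := by
    simp [VectorCalculus.divergence]

/-- **(A)** Dropping `0 < H t` makes the crux FALSE: witness `ν = 1`, `C = 0`, `Λ₀ = 0`,
`v ≡ 0`, `q ≡ 0`, `K` = backward heat kernel at `(0,0)`; then `H ≡ 0`, `Λ ≡ 0/0 = 0`. -/
theorem frequencyRigidity_false_without_posH : ¬ FrequencyRigidityWithoutPosH := by
  intro h
  refine h ⟨1, 0, 0, fun _ _ => 0, fun _ _ => 0, backwardHeatKernel 1 0 (0 : E3), one_pos,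
    isClassicalNSSolutionOn_zero _ _, ?_, ?_, comparable_backwardHeatKernel one_pos, ?_⟩
  · intro t ht x; simp
  · exact kernelClauses_backwardHeatKernel one_pos _ (fun t ht x => by simp)
  · intro H Λ hH hΛ t ht
    have hH0 : H t = 0 := by rw [hH]; simp
    rw [hΛ]; simp [hH0]


/-! ### (T) Structure of the frequency clause: constant frequency ⇔ exact power law; the
exponent is pinned to the self-similar value `Λ₀ = 2` by two-ended enstrophy bounds -/

/-- If the frequency clause holds with `Λ₀ ≠ 0`, the adapted enstrophy is differentiable at every
`t < 0`: otherwise Mathlib's `deriv` is the junk value `0` there and `Λ t = 0 ≠ Λ₀`. -/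
theorem FreqClause.differentiableAt {v : ℝ → E3 → E3} {K : ℝ → E3 → ℝ} {Λ₀ : ℝ}
    (h : FreqClause v K Λ₀) (hΛ : Λ₀ ≠ 0) {t : ℝ} (ht : t < 0) :
    DifferentiableAt ℝ (fun t => ∫ x, ‖curl (v t) x‖ ^ 2 * K t x) t := by
  by_contra hd
  have h1 := (h _ _ rfl rfl).2 t ht
  simp only [deriv_zero_of_not_differentiableAt hd, mul_zero, zero_div] at h1
  exact hΛ h1.symm

/-- **Constant frequency ⇔ exact power law.**  If the frequency clause holds with constant `Λ₀`
and the adapted enstrophy `H` is differentiable on `(−∞,0)` (automatic when `Λ₀ ≠ 0`,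
`FreqClause.differentiableAt`), then `H(t) = H(−1) · (−t)^{−Λ₀}` for every `t < 0`
(`(H · (−t)^{Λ₀})' = (−t)^{Λ₀−1} ((−t)H' − Λ₀ H) = 0` on the connected open set `(−∞,0)`). -/
theorem FreqClause.power_law {v : ℝ → E3 → E3} {K : ℝ → E3 → ℝ} {Λ₀ : ℝ}
    (h : FreqClause v K Λ₀)
    (hd : ∀ t < 0, DifferentiableAt ℝ (fun t => ∫ x, ‖curl (v t) x‖ ^ 2 * K t x) t)
    {t : ℝ} (ht : t < 0) :
    (∫ x, ‖curl (v t) x‖ ^ 2 * K t x) =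
      (∫ x, ‖curl (v (-1)) x‖ ^ 2 * K (-1) x) * (-t) ^ (-Λ₀) := by
  set H : ℝ → ℝ := fun t => ∫ x, ‖curl (v t) x‖ ^ 2 * K t x with hH
  have hcl := h H _ rfl rfl
  -- the ODE `(−s) H'(s) = Λ₀ H(s)` on `s < 0`
  have hode : ∀ s < 0, (0 - s) * deriv H s = Λ₀ * H s := fun s hs => by
    have h1 := hcl.2 s hs
    have hpos := hcl.1 s hs
    field_simp at h1
    linarith [h1]
  -- `G s = H s * (−s)^Λ₀` has zero derivative on `(−∞,0)`
  set G : ℝ → ℝ := fun s => H s * (-s) ^ Λ₀ with hG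
  have hGd : ∀ s < 0, HasDerivAt G 0 s := fun s hs => by
    have hHs : HasDerivAt H (deriv H s) s := (hd s hs).hasDerivAt
    have hps : HasDerivAt (fun r : ℝ => (-r) ^ Λ₀) ((-1) * Λ₀ * (-s) ^ (Λ₀ - 1)) s :=
      (hasDerivAt_neg s).rpow_const (Or.inl (by linarith))
    have := hHs.mul hps
    refine this.congr_deriv ?_
    have hs' : (-s) ^ Λ₀ = (-s) ^ (Λ₀ - 1) * (-s) := by
      rw [← Real.rpow_add_one (by linarith : (-s) ≠ 0), sub_add_cancel]
    rw [hs']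
    linear_combination (-s) ^ (Λ₀ - 1) * hode s hs
  have hGconst : G t = G (-1) :=
    IsOpen.is_const_of_deriv_eq_zero isOpen_Iio (convex_Iio 0).isPreconnected
      (fun s hs => (hGd s hs).differentiableAt.differentiableWithinAt)
      (fun s hs => (hGd s hs).deriv) ht (by norm_num)
  have hG1 : G (-1) = H (-1) := by simp [hG]
  have hpow : (-t) ^ Λ₀ * (-t) ^ (-Λ₀) = 1 := by
    rw [Real.rpow_neg (by linarith), mul_inv_cancel₀]
    exact (Real.rpow_pos_of_pos (by linarith) _).ne'
  calc H t = G t * (-t) ^ (-Λ₀) := by simp only [hG]; rw [mul_assoc, hpow, mul_one]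
    _ = H (-1) * (-t) ^ (-Λ₀) := by rw [hGconst, hG1]

/-- Power-law comparison near `s → 0⁺`: `A s^{−Λ₀} ≤ M s^{−2}` on `(0,1)` with `A > 0` forces
`Λ₀ ≤ 2`. -/
theorem exponent_le_two_of_bound_near_zero {A M Λ₀ : ℝ} (hA : 0 < A)
    (h : ∀ s ∈ Ioo (0:ℝ) 1, A * s ^ (-Λ₀) ≤ M * s ^ (-(2:ℝ))) : Λ₀ ≤ 2 := by
  by_contra hΛ'
  have hΛ : 2 < Λ₀ := not_le.mp hΛ'
  -- `N ↦ N^{Λ₀-2} → ∞`; pick `N > 1` with `N^{Λ₀-2} > M/A` and test `s = N⁻¹`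
  have ht := tendsto_rpow_atTop (show 0 < Λ₀ - 2 by linarith)
  obtain ⟨N, hN1, hN⟩ := ((eventually_gt_atTop (1:ℝ)).and (ht.eventually_gt_atTop (M / A))).exists
  have hN0 : 0 < N := by linarith
  have hs : N⁻¹ ∈ Ioo (0:ℝ) 1 := ⟨inv_pos.2 hN0, inv_lt_one_of_one_lt₀ hN1⟩
  have h1 := h _ hs
  rw [Real.inv_rpow hN0.le, Real.inv_rpow hN0.le, Real.rpow_neg hN0.le, Real.rpow_neg hN0.le,
    inv_inv, inv_inv] at h1
  -- h1 : A * N ^ Λ₀ ≤ M * N ^ 2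
  have h2 : N ^ (Λ₀ - 2) * N ^ (2:ℝ) = N ^ Λ₀ := by
    rw [← Real.rpow_add hN0, sub_add_cancel]
  have h3 : 0 < N ^ (2:ℝ) := Real.rpow_pos_of_pos hN0 _
  have h4 : M / A < N ^ (Λ₀ - 2) := hN
  rw [div_lt_iff₀ hA] at h4
  nlinarith [mul_lt_mul_of_pos_right h4 h3]

/-- Power-law comparison near `s → ∞`: `A s^{−Λ₀} ≤ M s^{−2}` on `(1,∞)` with `A > 0` forces
`2 ≤ Λ₀`. -/
theorem two_le_exponent_of_bound_near_infty {A M Λ₀ : ℝ} (hA : 0 < A)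
    (h : ∀ s : ℝ, 1 < s → A * s ^ (-Λ₀) ≤ M * s ^ (-(2:ℝ))) : 2 ≤ Λ₀ := by
  by_contra hΛ'
  have hΛ : Λ₀ < 2 := not_le.mp hΛ'
  have ht := tendsto_rpow_atTop (show 0 < 2 - Λ₀ by linarith)
  obtain ⟨N, hN1, hN⟩ := ((eventually_gt_atTop (1:ℝ)).and (ht.eventually_gt_atTop (M / A))).exists
  have hN0 : 0 < N := by linarith
  have h1 := h N hN1
  rw [Real.rpow_neg hN0.le, Real.rpow_neg hN0.le] at h1
  have h2 : N ^ (2 - Λ₀) * N ^ Λ₀ = N ^ (2:ℝ) := by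
    rw [← Real.rpow_add hN0, sub_add_cancel]
  have h3 : 0 < N ^ Λ₀ := Real.rpow_pos_of_pos hN0 _
  have h5 : 0 < N ^ (2:ℝ) := Real.rpow_pos_of_pos hN0 _
  have h4 : M / A < N ^ (2 - Λ₀) := hN
  rw [div_lt_iff₀ hA] at h4
  -- from h1: A / N^Λ₀ ≤ M / N^2, i.e. A N^2 ≤ M N^Λ₀
  have h6 : A * N ^ (2:ℝ) ≤ M * N ^ Λ₀ := by
    have := h1
    rw [← div_eq_mul_inv, ← div_eq_mul_inv, div_le_div_iff₀ h3 h5] at this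
    linarith
  nlinarith [mul_lt_mul_of_pos_right h4 h3]

/-- **The exponent is pinned to the self-similar value.**  If the frequency clause holds, the
adapted enstrophy is differentiable on `(−∞,0)` (automatic for `Λ₀ ≠ 0`) and obeys the two-ended
Type-I ENSTROPHY bound `H(t) ≤ M (−t)^{−2}` for all `t < 0` — which for an honest ancient
Type-I flow follows from the scale-invariant gradient estimate `|∇v(t)| ≲ (−t)^{−1}` and
`∫ K = 1` — then `Λ₀ = 2` and `H(t) = H(−1)(−t)^{−2}` EXACTLY: a counterexample must reproduce
the backward self-similar enstrophy law on the nose (`(−t)² H(t)` is what is log-periodic and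
generically non-constant on a `λ`-DSS flow), and a prover may reduce to the equality case
`Λ₀ = 2`. -/
theorem FreqClause.exponent_eq_two {v : ℝ → E3 → E3} {K : ℝ → E3 → ℝ} {Λ₀ M : ℝ}
    (h : FreqClause v K Λ₀)
    (hd : ∀ t < 0, DifferentiableAt ℝ (fun t => ∫ x, ‖curl (v t) x‖ ^ 2 * K t x) t)
    (hM : ∀ t < 0, (∫ x, ‖curl (v t) x‖ ^ 2 * K t x) ≤ M * (-t) ^ (-(2:ℝ))) : Λ₀ = 2 := by
  set A : ℝ := ∫ x, ‖curl (v (-1)) x‖ ^ 2 * K (-1) x with hA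
  have hApos : 0 < A := (h _ _ rfl rfl).1 (-1) (by norm_num)
  have hlaw : ∀ s : ℝ, 0 < s → A * s ^ (-Λ₀) ≤ M * s ^ (-(2:ℝ)) := fun s hs => by
    have h1 := h.power_law hd (show -s < 0 by linarith)
    have h2 := hM (-s) (by linarith)
    rw [h1, neg_neg] at h2
    exact h2
  exact le_antisymm (exponent_le_two_of_bound_near_zero hApos fun s hs => hlaw s hs.1)
    (two_le_exponent_of_bound_near_infty hApos fun s hs => hlaw s (by linarith))

/-! ### (B) The GLOBAL Type-I bound is load-bearing: rigid rotation -/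

/-- `e₃ = (0,0,1)`. -/
def e₃ : E3 := EuclideanSpace.single 2 1

/-- The generator of rigid rotation about the `x₃`-axis, `rot x = e₃ × x = (−x₂, x₁, 0)`
(the tree's bilinear `crossCLM`). -/
def rot : E3 →L[ℝ] E3 := crossCLM e₃

/-- Unfolding `rot`. -/
theorem rot_apply (x : E3) : rot x = cross e₃ x := rfl

/-- First coordinate of `e₃ × x`. -/
@[simp] theorem rot_apply_zero (x : E3) : rot x 0 = -(x 1) := by
  simp [rot_apply, cross, cross_apply, e₃]

/-- Second coordinate of `e₃ × x`. -/
@[simp] theorem rot_apply_one (x : E3) : rot x 1 = x 0 := by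
  simp [rot_apply, cross, cross_apply, e₃]

/-- Third coordinate of `e₃ × x`. -/
@[simp] theorem rot_apply_two (x : E3) : rot x 2 = 0 := by
  simp [rot_apply, cross, cross_apply, e₃]

/-- Rigid rotation is tangent to the spheres about the origin (coordinates; the tree's
`inner_fin3`-type expansions are inlined to keep this file import-light). -/
theorem inner_self_rot (x : E3) : ⟪x, rot x⟫ = 0 := by
  rw [EuclideanSpace.inner_eq_star_dotProduct, star_trivial, dotProduct, Fin.sum_univ_three]
  simp only [rot_apply_zero, rot_apply_one, rot_apply_two]
  ring

/-- `rot` is skew-adjoint. -/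
theorem rot_skew (x y : E3) : ⟪rot x, y⟫ = -⟪x, rot y⟫ := by
  rw [EuclideanSpace.inner_eq_star_dotProduct, EuclideanSpace.inner_eq_star_dotProduct,
    star_trivial, star_trivial, dotProduct, dotProduct, Fin.sum_univ_three, Fin.sum_univ_three]
  simp only [rot_apply_zero, rot_apply_one, rot_apply_two]
  ring

/-- `‖e₃ × x‖ ≤ ‖x‖`. -/
theorem norm_rot_le (x : E3) : ‖rot x‖ ≤ ‖x‖ := by
  have h : ‖rot x‖ ^ 2 ≤ ‖x‖ ^ 2 := by
    rw [EuclideanSpace.real_norm_sq_eq, EuclideanSpace.real_norm_sq_eq, Fin.sum_univ_three,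
      Fin.sum_univ_three]
    simp only [rot_apply_zero, rot_apply_one, rot_apply_two]
    nlinarith [sq_nonneg (x 2)]
  exact (sq_le_sq₀ (norm_nonneg _) (norm_nonneg _)).1 h

/-- The vorticity of rigid rotation with unit angular velocity is `2e₃`. -/
theorem curl_rot (x : E3) : curl (⇑rot) x = (2:ℝ) • e₃ := by
  simp only [curl, ContinuousLinearMap.fderiv]
  ext i
  fin_cases i <;> (simp [rot_apply, cross, cross_apply, e₃]; try norm_num)

/-- `‖curl (e₃ × ·)‖² = 4`. -/
theorem norm_curl_rot_sq (x : E3) : ‖curl (⇑rot) x‖ ^ 2 = 4 := by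
  rw [curl_rot, norm_smul, e₃, PiLp.norm_single]
  norm_num

/-- **Rigid rotation is a smooth (steady, hence ancient) classical NS flow** on any time set, with
pressure `q = ½‖e₃ × x‖² = ½(x₁² + x₂²)`: `(v·∇)v = rot (rot x) = −∇q`, `Δv = 0`, `div v = 0`. -/
theorem isClassicalNSSolutionOn_rot (S : Set ℝ) (ν : ℝ) :
    IsClassicalNSSolutionOn S ν 0 (fun _ x => rot x) (fun _ x => 2⁻¹ * ‖rot x‖ ^ 2) where
  smooth_velocity := (rot.contDiff.comp contDiff_snd).contDiffOn
  smooth_pressure := ((contDiff_const.mul (rot.contDiff.norm_sq ℝ)).comp contDiff_snd).contDiffOn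
  momentum t ht x := by
    have hsq : HasFDerivAt (fun y : E3 => 2⁻¹ * ‖rot y‖ ^ 2)
        ((2⁻¹ : ℝ) • ((2 • innerSL ℝ (rot x)).comp rot)) x :=
      (((hasStrictFDerivAt_norm_sq (rot x)).hasFDerivAt.comp x rot.hasFDerivAt).const_mul 2⁻¹)
    have hP : HasFDerivAt (fun y : E3 => 2⁻¹ * ‖rot y‖ ^ 2)
        (InnerProductSpace.toDual ℝ E3 (-(rot (rot x)))) x := by
      refine hsq.congr_fderiv (ContinuousLinearMap.ext fun h => ?_)
      simp only [_root_.smul_apply, ContinuousLinearMap.comp_apply,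
        innerSL_apply_apply, InnerProductSpace.toDual_apply_apply, inner_neg_left, smul_eq_mul,
        nsmul_eq_mul, Nat.cast_ofNat]
      rw [rot_skew (rot x) h]
      ring
    have hgrad : gradient (fun y : E3 => 2⁻¹ * ‖rot y‖ ^ 2) x = -(rot (rot x)) :=
      (hasGradientAt_iff_hasFDerivAt.mpr hP).gradient
    have hΔ : (Δ (fun y : E3 => rot y)) x = 0 := laplacian_clm rot x
    have hconv : convect (fun y : E3 => rot y) (fun y : E3 => rot y) x = rot (rot x) := by
      rw [convect_apply, show (fun y : E3 => rot y) = ⇑rot from rfl, ContinuousLinearMap.fderiv]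
    simp only [timeDerivWithin_apply, derivWithin_fun_const, Pi.zero_apply, zero_add, add_zero,
      smul_zero, zero_sub, hconv, hΔ, hgrad, neg_neg]
  divFree t ht x := by
    show VectorCalculus.divergence (⇑rot) x = 0
    rw [divergence_eq_sum_inner_fderiv (stdOrthonormalBasis ℝ E3)]
    refine Finset.sum_eq_zero fun i _ => ?_
    rw [ContinuousLinearMap.fderiv]
    have h1 := rot_skew (stdOrthonormalBasis ℝ E3 i) (stdOrthonormalBasis ℝ E3 i)
    rw [real_inner_comm] at h1
    linarith

/-- Type-I bound only on the unit backward parabolic cylinder `Q₁(0,0) = (−1,0) × B̄₁(0)` —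
the LOCAL form natural at a backward-singular point. -/
def LocalTypeIBound (C : ℝ) (v : ℝ → E3 → E3) : Prop :=
  ∀ t ∈ Ioo (-1:ℝ) 0, ∀ x : E3, ‖x‖ ≤ 1 → ‖v t x‖ ≤ C / Real.sqrt (-t)

/-- The global Type-I bound implies the local one. -/
theorem TypeIBound.localTypeIBound {C : ℝ} {v : ℝ → E3 → E3} (h : TypeIBound C v) :
    LocalTypeIBound C v :=
  fun t ht x _ => h t ht.2 x

/-- The crux with the Type-I clause DROPPED. -/
def FrequencyRigidityWithoutTypeI : Prop :=
  ¬ ∃ (ν Λ₀ : ℝ) (v : ℝ → E3 → E3) (q : ℝ → E3 → ℝ) (K : ℝ → E3 → ℝ), 0 < ν ∧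
    IsClassicalNSSolutionOn (Iio 0) ν 0 v q ∧ KernelClauses ν v K ∧ Comparable K ∧
    FreqClause v K Λ₀

/-- The crux with the GLOBAL Type-I clause replaced by the LOCAL one on `Q₁(0,0)`. -/
def FrequencyRigidityLocalTypeI : Prop :=
  ¬ ∃ (ν C Λ₀ : ℝ) (v : ℝ → E3 → E3) (q : ℝ → E3 → ℝ) (K : ℝ → E3 → ℝ), 0 < ν ∧
    IsClassicalNSSolutionOn (Iio 0) ν 0 v q ∧ LocalTypeIBound C v ∧ KernelClauses ν v K ∧
    Comparable K ∧ FreqClause v K Λ₀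

/-- Dropping the bound is stronger than localising it. -/
theorem frequencyRigidityLocalTypeI_of_withoutTypeI (h : FrequencyRigidityWithoutTypeI) :
    FrequencyRigidityLocalTypeI := by
  rintro ⟨ν, C, Λ₀, v, q, K, hν, hNS, -, hK, hC, hF⟩
  exact h ⟨ν, Λ₀, v, q, K, hν, hNS, hK, hC, hF⟩

/-- Both variants are strengthenings of the crux. -/
theorem frequencyRigidity_of_localTypeI (h : FrequencyRigidityLocalTypeI) :
    Theses.AdaptedFrequency.FrequencyRigidity := by
  rw [frequencyRigidity_iff]
  rintro ⟨ν, C, Λ₀, v, q, K, hν, hNS, hTI, hK, hC, hF⟩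
  exact h ⟨ν, C, Λ₀, v, q, K, hν, hNS, hTI.localTypeIBound, hK, hC, hF⟩

/-- The no-Type-I variant is a strengthening of the crux. -/
theorem frequencyRigidity_of_withoutTypeI (h : FrequencyRigidityWithoutTypeI) :
    Theses.AdaptedFrequency.FrequencyRigidity :=
  frequencyRigidity_of_localTypeI (frequencyRigidityLocalTypeI_of_withoutTypeI h)

/-- The adapted enstrophy of rigid rotation against the heat kernel is the constant `4`. -/
theorem adaptedEnstrophy_rot {ν : ℝ} (hν : 0 < ν) {t : ℝ} (ht : t < 0) :
    (∫ x, ‖curl ((fun (_ : ℝ) (x : E3) => rot x) t) x‖ ^ 2 * backwardHeatKernel ν 0 (0:E3) t x)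
      = 4 := by
  have h1 : ∀ x, ‖curl ((fun (_ : ℝ) (x : E3) => rot x) t) x‖ ^ 2 = 4 := fun x =>
    norm_curl_rot_sq x
  simp_rw [h1, integral_const_mul, integral_backwardHeatKernel hν (0:E3) ht, mul_one]

/-- The frequency clause holds for rigid rotation with `Λ₀ = 0` (`H ≡ 4`, `H' ≡ 0`). -/
theorem freqClause_rot {ν : ℝ} (hν : 0 < ν) :
    FreqClause (fun _ x => rot x) (backwardHeatKernel ν 0 (0:E3)) 0 := by
  intro H Λ hH hΛ
  have hH4 : ∀ t ∈ Iio (0:ℝ), H t = 4 := fun t ht => by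
    rw [hH]; exact adaptedEnstrophy_rot hν ht
  refine ⟨fun t ht => by rw [hH4 t ht]; norm_num, fun t ht => ?_⟩
  have hev : H =ᶠ[𝓝 t] fun _ => (4:ℝ) :=
    Filter.eventuallyEq_of_mem (Iio_mem_nhds ht) fun s hs => hH4 s hs
  rw [hΛ]
  simp only [hev.deriv_eq, deriv_const, mul_zero, zero_div]

/-- **(B, sharp form)** Replacing the global Type-I bound by the LOCAL one on `Q₁(0,0)` makes
the crux FALSE: rigid rotation `v = e₃ × x` (with `‖v‖ ≤ ‖x‖ ≤ 1 ≤ 1/√(−t)` on `Q₁`),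
`q = ½(x₁² + x₂²)`, `K` = heat kernel, `Λ₀ = 0`, `H ≡ 4`. -/
theorem frequencyRigidity_false_with_local_typeI : ¬ FrequencyRigidityLocalTypeI := by
  intro h
  refine h ⟨1, 1, 0, fun _ x => rot x, fun _ x => 2⁻¹ * ‖rot x‖ ^ 2, backwardHeatKernel 1 0 (0:E3),
    one_pos, isClassicalNSSolutionOn_rot _ _, ?_, ?_, comparable_backwardHeatKernel one_pos,
    freqClause_rot one_pos⟩
  · intro t ht x hx
    have hst : 0 < Real.sqrt (-t) := Real.sqrt_pos.2 (by linarith [ht.2])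
    have hs1 : Real.sqrt (-t) ≤ 1 := Real.sqrt_le_one.mpr (by linarith [ht.1]) |>.trans_eq' rfl
    rw [le_div_iff₀ hst]
    calc ‖rot x‖ * Real.sqrt (-t) ≤ ‖x‖ * 1 :=
          mul_le_mul (norm_rot_le x) hs1 hst.le (norm_nonneg _)
      _ ≤ 1 := by simpa using hx
  · exact kernelClauses_backwardHeatKernel one_pos _ (fun t _ x => inner_self_rot x)

/-- **(B)** Dropping the Type-I bound makes the crux FALSE (corollary of the sharp form). -/
theorem frequencyRigidity_false_without_typeI : ¬ FrequencyRigidityWithoutTypeI :=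
  fun h => frequencyRigidity_false_with_local_typeI (frequencyRigidityLocalTypeI_of_withoutTypeI h)


/-! ### (B′) … even with an arbitrarily SMALL local Type-I constant

Contrast: the GLOBAL statement is TRUE for small `C` (gap argument in the module docstring), but
the LOCAL one is false for every `C = |Ω| > 0`: slow rigid rotation `v = Ω e₃ × x`. -/

/-- Every skew-adjoint linear field `v = A x` with pressure `q = ½‖A x‖²` is a smooth steady
classical NS flow on any time set (`(v·∇)v = A(Ax) = −∇q`, `Δv = 0`, `div v = tr A = 0`). -/
theorem isClassicalNSSolutionOn_skew (A : E3 →L[ℝ] E3) (hA : ∀ x y : E3, ⟪A x, y⟫ = -⟪x, A y⟫)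
    (S : Set ℝ) (ν : ℝ) :
    IsClassicalNSSolutionOn S ν 0 (fun _ x => A x) (fun _ x => 2⁻¹ * ‖A x‖ ^ 2) where
  smooth_velocity := (A.contDiff.comp contDiff_snd).contDiffOn
  smooth_pressure := ((contDiff_const.mul (A.contDiff.norm_sq ℝ)).comp contDiff_snd).contDiffOn
  momentum t ht x := by
    have hsq : HasFDerivAt (fun y : E3 => 2⁻¹ * ‖A y‖ ^ 2)
        ((2⁻¹ : ℝ) • ((2 • innerSL ℝ (A x)).comp A)) x :=
      (((hasStrictFDerivAt_norm_sq (A x)).hasFDerivAt.comp x A.hasFDerivAt).const_mul 2⁻¹)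
    have hP : HasFDerivAt (fun y : E3 => 2⁻¹ * ‖A y‖ ^ 2)
        (InnerProductSpace.toDual ℝ E3 (-(A (A x)))) x := by
      refine hsq.congr_fderiv (ContinuousLinearMap.ext fun h => ?_)
      simp only [_root_.smul_apply, ContinuousLinearMap.comp_apply,
        innerSL_apply_apply, InnerProductSpace.toDual_apply_apply, inner_neg_left, smul_eq_mul,
        nsmul_eq_mul, Nat.cast_ofNat]
      rw [hA (A x) h]
      ring
    have hgrad : gradient (fun y : E3 => 2⁻¹ * ‖A y‖ ^ 2) x = -(A (A x)) :=
      (hasGradientAt_iff_hasFDerivAt.mpr hP).gradient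
    have hΔ : (Δ (fun y : E3 => A y)) x = 0 := laplacian_clm A x
    have hconv : convect (fun y : E3 => A y) (fun y : E3 => A y) x = A (A x) := by
      rw [convect_apply, show (fun y : E3 => A y) = ⇑A from rfl, ContinuousLinearMap.fderiv]
    simp only [timeDerivWithin_apply, derivWithin_fun_const, Pi.zero_apply, zero_add, add_zero,
      smul_zero, zero_sub, hconv, hΔ, hgrad, neg_neg]
  divFree t ht x := by
    show VectorCalculus.divergence (⇑A) x = 0
    rw [divergence_eq_sum_inner_fderiv (stdOrthonormalBasis ℝ E3)]
    refine Finset.sum_eq_zero fun i _ => ?_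
    rw [ContinuousLinearMap.fderiv]
    have h1 := hA (stdOrthonormalBasis ℝ E3 i) (stdOrthonormalBasis ℝ E3 i)
    rw [real_inner_comm] at h1
    linarith

/-- `Ω • rot` is skew-adjoint. -/
theorem smul_rot_skew (Ω : ℝ) (x y : E3) : ⟪(Ω • rot) x, y⟫ = -⟪x, (Ω • rot) y⟫ := by
  show ⟪Ω • rot x, y⟫ = -⟪x, Ω • rot y⟫
  rw [inner_smul_left, inner_smul_right, rot_skew, conj_trivial]
  ring

/-- Vorticity of slow rigid rotation: `curl (Ω e₃ × ·) = 2Ω e₃`. -/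
theorem curl_smul_rot (Ω : ℝ) (x : E3) : curl (⇑(Ω • rot)) x = (2 * Ω) • e₃ := by
  simp only [curl, ContinuousLinearMap.fderiv]
  ext i
  fin_cases i <;> (simp [rot_apply, cross, cross_apply, e₃]; try ring)

/-- **(B′)** For every `Ω ≠ 0` the slow rigid rotation `v = Ω e₃ × x` (local Type-I constant
`C = |Ω|` on `Q₁(0,0)`, as small as desired), `q = ½‖Ω e₃ × x‖²`, `K` = heat kernel, `Λ₀ = 0`,
`H ≡ 4Ω²`, witnesses the failure of the LOCAL-Type-I variant.  So smallness of a local Type-I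
constant buys nothing, while the GLOBAL crux is true for small `C` (gap). -/
theorem localTypeI_witness_small {Ω : ℝ} (hΩ : Ω ≠ 0) :
    ∃ (v : ℝ → E3 → E3) (q : ℝ → E3 → ℝ) (K : ℝ → E3 → ℝ),
      IsClassicalNSSolutionOn (Iio 0) 1 0 v q ∧ LocalTypeIBound |Ω| v ∧ KernelClauses 1 v K ∧
      Comparable K ∧ FreqClause v K 0 := by
  refine ⟨fun _ x => (Ω • rot) x, fun _ x => 2⁻¹ * ‖(Ω • rot) x‖ ^ 2, backwardHeatKernel 1 0 (0:E3),
    isClassicalNSSolutionOn_skew _ (smul_rot_skew Ω) _ _, ?_, ?_, comparable_backwardHeatKernel one_pos,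
    ?_⟩
  · intro t ht x hx
    have hst : 0 < Real.sqrt (-t) := Real.sqrt_pos.2 (by linarith [ht.2])
    have hs1 : Real.sqrt (-t) ≤ 1 := Real.sqrt_le_one.mpr (by linarith [ht.1])
    show ‖Ω • rot x‖ ≤ |Ω| / Real.sqrt (-t)
    rw [le_div_iff₀ hst, norm_smul, Real.norm_eq_abs]
    calc |Ω| * ‖rot x‖ * Real.sqrt (-t) ≤ |Ω| * ‖x‖ * 1 :=
          mul_le_mul (mul_le_mul_of_nonneg_left (norm_rot_le x) (abs_nonneg _)) hs1 hst.le
            (mul_nonneg (abs_nonneg _) (norm_nonneg _))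
      _ ≤ |Ω| := by nlinarith [abs_nonneg Ω]
  · refine kernelClauses_backwardHeatKernel one_pos _ (fun t _ x => ?_)
    show ⟪x, Ω • rot x⟫ = 0
    rw [inner_smul_right, inner_self_rot, mul_zero]
  · intro H Λ hH hΛ
    have hH4 : ∀ t ∈ Iio (0:ℝ), H t = 4 * Ω ^ 2 := fun t ht => by
      rw [hH]
      have h1 : ∀ x, ‖curl ((fun (_ : ℝ) (x : E3) => (Ω • rot) x) t) x‖ ^ 2 = 4 * Ω ^ 2 :=
        fun x => by
          show ‖curl (⇑(Ω • rot)) x‖ ^ 2 = 4 * Ω ^ 2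
          rw [curl_smul_rot, norm_smul, e₃, PiLp.norm_single, Real.norm_eq_abs]
          simp only [norm_one, mul_one]
          rw [sq_abs]
          ring
      simp_rw [h1, integral_const_mul, integral_backwardHeatKernel one_pos (0:E3) ht, mul_one]
    refine ⟨fun t ht => by rw [hH4 t ht]; positivity, fun t ht => ?_⟩
    have hev : H =ᶠ[𝓝 t] fun _ => (4 * Ω ^ 2 : ℝ) :=
      Filter.eventuallyEq_of_mem (Iio_mem_nhds ht) fun s hs => hH4 s hs
    rw [hΛ]
    simp only [hev.deriv_eq, deriv_const, mul_zero, zero_div]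

/-- (B′) packaged: the local-Type-I variant fails with every prescribed constant `C > 0`. -/
theorem frequencyRigidity_false_with_local_typeI_small {C : ℝ} (hC : 0 < C) :
    ∃ (ν Λ₀ : ℝ) (v : ℝ → E3 → E3) (q : ℝ → E3 → ℝ) (K : ℝ → E3 → ℝ), 0 < ν ∧
      IsClassicalNSSolutionOn (Iio 0) ν 0 v q ∧ LocalTypeIBound C v ∧ KernelClauses ν v K ∧
      Comparable K ∧ FreqClause v K Λ₀ := by
  obtain ⟨v, q, K, h1, h2, h3, h4, h5⟩ := localTypeI_witness_small hC.ne'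
  exact ⟨1, 0, v, q, K, one_pos, h1, by rwa [abs_of_pos hC] at h2, h3, h4, h5⟩

/-! ### (C) The momentum equation is load-bearing: a backward self-similar swirling field -/

/-- Radial cutoff `χ y = smoothTransition (2 − ‖y‖²)`: smooth, `= 1` on `‖y‖ ≤ 1`,
`= 0` on `‖y‖² ≥ 2`, values in `[0,1]`. -/
def χ (y : E3) : ℝ := Real.smoothTransition (2 - ‖y‖ ^ 2)

/-- The cutoff is smooth. -/
theorem χ_contDiff {n : ℕ∞} : ContDiff ℝ n χ :=
  Real.smoothTransition.contDiff.comp (contDiff_const.sub (contDiff_norm_sq ℝ))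

/-- The cutoff is `1` on the closed unit ball. -/
theorem χ_eq_one {y : E3} (hy : ‖y‖ ^ 2 ≤ 1) : χ y = 1 :=
  Real.smoothTransition.one_of_one_le (by linarith)

/-- The cutoff vanishes where `‖y‖² ≥ 2`. -/
theorem χ_eq_zero {y : E3} (hy : 2 ≤ ‖y‖ ^ 2) : χ y = 0 :=
  Real.smoothTransition.zero_of_nonpos (by linarith)

/-- The cutoff is nonnegative. -/
theorem χ_nonneg (y : E3) : 0 ≤ χ y := Real.smoothTransition.nonneg _

/-- The cutoff is at most `1`. -/
theorem χ_le_one (y : E3) : χ y ≤ 1 := Real.smoothTransition.le_one _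

/-- The cutoff is radial: its derivative is a multiple of `⟪y, ·⟫`. -/
theorem hasFDerivAt_χ (y : E3) :
    HasFDerivAt χ (deriv Real.smoothTransition (2 - ‖y‖ ^ 2) • (-((2:ℕ) • innerSL ℝ y))) y := by
  have h1 : HasFDerivAt (fun y : E3 => 2 - ‖y‖ ^ 2) (-((2:ℕ) • innerSL ℝ y)) y := by
    simpa using (hasStrictFDerivAt_norm_sq y).hasFDerivAt.const_sub (2:ℝ)
  have h2 : HasDerivAt Real.smoothTransition (deriv Real.smoothTransition (2 - ‖y‖ ^ 2))
      (2 - ‖y‖ ^ 2) :=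
    ((Real.smoothTransition.contDiff (n := 1)).differentiable (by simp) _).hasDerivAt
  exact h2.comp_hasFDerivAt y h1

/-- The cutoff does not vary along the rotation field. -/
theorem fderiv_χ_rot (y : E3) : fderiv ℝ χ y (rot y) = 0 := by
  rw [(hasFDerivAt_χ y).fderiv]
  simp [inner_self_rot]

/-- The profile `V y = χ(y) · (e₃ × y)`: smooth, compactly supported, divergence-free,
tangent to the spheres about `0`, and equal to `rot` on the unit ball. -/
def V (y : E3) : E3 := χ y • rot y

/-- The profile is smooth. -/
theorem V_contDiff {n : ℕ∞} : ContDiff ℝ n V := χ_contDiff.smul rot.contDiff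

/-- The profile vanishes where `‖y‖² ≥ 2`. -/
theorem V_eq_zero {y : E3} (hy : 2 ≤ ‖y‖ ^ 2) : V y = 0 := by
  simp [V, χ_eq_zero hy]

/-- The profile has compact support (in the closed ball of radius `2`). -/
theorem hasCompactSupport_V : HasCompactSupport V := by
  refine HasCompactSupport.intro (isCompact_closedBall (0:E3) 2) fun y hy => V_eq_zero ?_
  have h2 : 2 < ‖y‖ := by simpa [dist_eq_norm] using hy
  nlinarith

/-- The profile is bounded by `2`. -/
theorem norm_V_le (y : E3) : ‖V y‖ ≤ 2 := by
  by_cases hy : 2 ≤ ‖y‖ ^ 2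
  · simp [V_eq_zero hy]
  · have h1 : ‖y‖ ≤ 2 := by nlinarith [norm_nonneg y]
    calc ‖V y‖ = χ y * ‖rot y‖ := by rw [V, norm_smul, Real.norm_of_nonneg (χ_nonneg y)]
      _ ≤ 1 * ‖y‖ := mul_le_mul (χ_le_one y) (norm_rot_le y) (norm_nonneg _) zero_le_one
      _ ≤ 2 := by linarith

/-- The profile is tangent to the spheres about the origin. -/
theorem inner_self_V (y : E3) : ⟪y, V y⟫ = 0 := by
  rw [V, inner_smul_right, inner_self_rot, mul_zero]

/-- Product rule for the profile. -/
theorem hasFDerivAt_V (y : E3) :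
    HasFDerivAt V (χ y • rot + (fderiv ℝ χ y).smulRight (rot y)) y :=
  (hasFDerivAt_χ y).differentiableAt.hasFDerivAt.smul rot.hasFDerivAt

/-- `tr (e₃ × ·) = 0`. -/
theorem trace_rot : LinearMap.trace ℝ E3 (rot : E3 →ₗ[ℝ] E3) = 0 := by
  rw [LinearMap.trace_eq_sum_inner _ (stdOrthonormalBasis ℝ E3)]
  refine Finset.sum_eq_zero fun i _ => ?_
  have h1 := rot_skew (stdOrthonormalBasis ℝ E3 i) (stdOrthonormalBasis ℝ E3 i)
  rw [real_inner_comm] at h1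
  simp only [ContinuousLinearMap.coe_coe]
  linarith

/-- The profile is divergence-free: `div (χ rot) = χ tr(rot) + Dχ(rot y) = 0 + 0`. -/
theorem divergence_V (y : E3) : VectorCalculus.divergence V y = 0 := by
  rw [VectorCalculus.divergence, (hasFDerivAt_V y).fderiv, ContinuousLinearMap.toLinearMap_add,
    map_add, ContinuousLinearMap.toLinearMap_smul, map_smul, trace_rot, smul_zero, zero_add]
  rw [show ((fderiv ℝ χ y).smulRight (rot y) : E3 →ₗ[ℝ] E3) =
      ((fderiv ℝ χ y : E3 →L[ℝ] ℝ) : E3 →ₗ[ℝ] ℝ).smulRight (rot y) from rfl,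
    LinearMap.trace_smulRight]
  exact fderiv_χ_rot y

/-- On a neighbourhood of the origin the profile IS rigid rotation. -/
theorem V_eventuallyEq_rot : V =ᶠ[𝓝 (0:E3)] (⇑rot) := by
  have h : Metric.ball (0:E3) 1 ∈ 𝓝 (0:E3) := Metric.ball_mem_nhds 0 one_pos
  filter_upwards [h] with y hy
  have hy1 : ‖y‖ ^ 2 ≤ 1 := by
    have : ‖y‖ < 1 := by simpa using hy
    nlinarith [norm_nonneg y]
  simp [V, χ_eq_one hy1]

/-- At the origin the vorticity of the profile is `2e₃`. -/
theorem curl_V_zero : curl V 0 = (2:ℝ) • e₃ := by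
  have h : fderiv ℝ V 0 = fderiv ℝ (⇑rot) 0 := V_eventuallyEq_rot.fderiv_eq
  have h2 : curl V 0 = curl (⇑rot) 0 := by simp only [curl, h]
  rw [h2, curl_rot]

/-- Continuity of the curl of a `C¹` field. -/
theorem continuous_curl {W : E3 → E3} (hW : ContDiff ℝ 1 W) : Continuous fun y => curl W y := by
  have hc : Continuous (fderiv ℝ W) := hW.continuous_fderiv one_ne_zero
  have hD : ∀ j i : Fin 3, Continuous fun y => fderiv ℝ W y (EuclideanSpace.single j 1) i :=
    fun j i => (continuous_apply i).comp ((PiLp.continuous_ofLp 2 _).comp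
      (hc.clm_apply continuous_const))
  unfold curl
  exact (PiLp.continuous_toLp 2 _).comp (((hD 1 2).sub (hD 2 1)).matrixVecCons
    (((hD 2 0).sub (hD 0 2)).matrixVecCons (((hD 0 1).sub (hD 1 0)).matrixVecCons
      continuous_const)))

/-- The curl of a compactly supported field is compactly supported. -/
theorem hasCompactSupport_curl {W : E3 → E3} (hW : HasCompactSupport W) :
    HasCompactSupport fun y => curl W y := by
  have h := (hW.fderiv ℝ).comp_left (g := fun L : E3 →L[ℝ] E3 =>
    WithLp.toLp 2 ![L (EuclideanSpace.single 1 1) 2 - L (EuclideanSpace.single 2 1) 1,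
      L (EuclideanSpace.single 2 1) 0 - L (EuclideanSpace.single 0 1) 2,
      L (EuclideanSpace.single 0 1) 1 - L (EuclideanSpace.single 1 1) 0]) (by simp)
  exact h

/-! #### Parabolic self-similar scaling -/

/-- Chain rule for the parabolic rescaling `z ↦ c W(c z)`: its derivative is `c² DW(c z)`. -/
theorem hasFDerivAt_smul_comp_smul {W : E3 → E3} {W' : E3 →L[ℝ] E3} (c : ℝ) {x : E3}
    (hW : HasFDerivAt W W' (c • x)) :
    HasFDerivAt (fun z => c • W (c • z)) ((c * c) • W') x := by
  have h1 : HasFDerivAt (fun z : E3 => c • z) (c • ContinuousLinearMap.id ℝ E3) x :=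
    (hasFDerivAt_id x).const_smul c
  have h2 := (hW.comp x h1).const_smul c
  refine h2.congr_fderiv (ContinuousLinearMap.ext fun z => ?_)
  simp [mul_smul]

/-- `curl (c W(c ·)) (x) = c² (curl W)(c x)`. -/
theorem curl_smul_comp_smul {W : E3 → E3} (c : ℝ) (x : E3) (hW : DifferentiableAt ℝ W (c • x)) :
    curl (fun z => c • W (c • z)) x = (c * c) • curl W (c • x) := by
  simp only [curl, (hasFDerivAt_smul_comp_smul c hW.hasFDerivAt).fderiv]
  ext i
  fin_cases i <;> simp [mul_sub]

/-- `div (c W(c ·)) (x) = c² (div W)(c x)`. -/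
theorem divergence_smul_comp_smul {W : E3 → E3} (c : ℝ) (x : E3)
    (hW : DifferentiableAt ℝ W (c • x)) :
    VectorCalculus.divergence (fun z => c • W (c • z)) x =
      (c * c) * VectorCalculus.divergence W (c • x) := by
  rw [VectorCalculus.divergence, (hasFDerivAt_smul_comp_smul c hW.hasFDerivAt).fderiv,
    ContinuousLinearMap.toLinearMap_smul, map_smul, VectorCalculus.divergence, smul_eq_mul]

/-- Similarity factor `sc t = 1/√(−t)`. -/
def sc (t : ℝ) : ℝ := (Real.sqrt (-t))⁻¹

/-- `sc t > 0` when `−t > 0`. -/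
theorem sc_pos {t : ℝ} (ht : 0 < -t) : 0 < sc t := inv_pos.2 (Real.sqrt_pos.2 ht)

/-- `sc(t)² = (−t)⁻¹`. -/
theorem sc_mul_sc {t : ℝ} (ht : t < 0) : sc t * sc t = (-t)⁻¹ := by
  rw [sc, ← mul_inv, Real.mul_self_sqrt (by linarith)]

/-- `sc(t)⁴ = t⁻²`. -/
theorem sc_pow_four {t : ℝ} (ht : t < 0) : sc t ^ 4 = (t ^ 2)⁻¹ := by
  rw [show sc t ^ 4 = (sc t * sc t) * (sc t * sc t) by ring, sc_mul_sc ht]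
  field_simp

/-- `sc` is smooth on `t < 0`. -/
theorem sc_contDiffAt {t : ℝ} (ht : t < 0) {n : WithTop ℕ∞} : ContDiffAt ℝ n sc t := by
  have h1 : ContDiffAt ℝ n (fun s : ℝ => Real.sqrt (-s)) t :=
    (Real.contDiffAt_sqrt (by linarith : -t ≠ 0)).comp t contDiffAt_id.neg
  exact h1.inv (Real.sqrt_ne_zero'.2 (by linarith))

/-- **The witness field**: `swirl t x = sc(t) V(sc(t) x)`, i.e. the backward self-similar field
with profile `V`; for `‖x‖ ≤ √(−t)` it is `(−t)⁻¹ e₃ × x`. -/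
def swirl (t : ℝ) (x : E3) : E3 := sc t • V (sc t • x)

/-- The witness field is jointly smooth on `(−∞,0) × ℝ³`. -/
theorem isSmoothSpaceTimeOn_swirl : IsSmoothSpaceTimeOn (Iio 0) swirl := by
  rintro ⟨t, x⟩ ⟨ht, -⟩
  apply ContDiffAt.contDiffWithinAt
  have hsc : ContDiffAt ℝ ∞ (fun p : ℝ × E3 => sc p.1) (t, x) :=
    ContDiffAt.comp (t, x) (g := sc) (f := Prod.fst) (sc_contDiffAt (show t < 0 from ht))
      contDiffAt_fst
  have hV : ContDiffAt ℝ ∞ (fun p : ℝ × E3 => V (sc p.1 • p.2)) (t, x) :=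
    (V_contDiff (n := ⊤)).contDiffAt.comp (t, x) (hsc.smul contDiffAt_snd)
  exact hsc.smul hV

/-- The witness field is divergence-free at every time. -/
theorem isDivFree_swirl (t : ℝ) : VectorCalculus.IsDivFree (swirl t) := by
  intro x
  show VectorCalculus.divergence (fun z => sc t • V (sc t • z)) x = 0
  rw [divergence_smul_comp_smul _ _ (hasFDerivAt_V _).differentiableAt, divergence_V, mul_zero]

/-- The witness field obeys the GLOBAL Type-I bound with constant `2`. -/
theorem typeIBound_swirl : TypeIBound 2 swirl := by
  intro t ht x
  have hsc := sc_pos (neg_pos.2 (show t < 0 from ht))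
  rw [swirl, norm_smul, Real.norm_of_nonneg hsc.le, sc, div_eq_mul_inv, mul_comm]
  exact mul_le_mul_of_nonneg_right (norm_V_le _) (inv_nonneg.2 (Real.sqrt_nonneg _))

/-- The witness field is tangent to the spheres about the origin. -/
theorem inner_self_swirl (t : ℝ) (x : E3) : ⟪x, swirl t x⟫ = 0 := by
  rw [swirl, inner_smul_right]
  rcases eq_or_ne (sc t) 0 with h | h
  · simp [h]
  · have := inner_self_V (sc t • x)
    rw [inner_smul_left] at this
    simp only [conj_trivial, mul_eq_zero, h, false_or] at this
    rw [this, mul_zero]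

/-- Scaling of the vorticity: `curl (swirl t)(x) = (−t)⁻¹ (curl V)(x/√(−t))`. -/
theorem curl_swirl (t : ℝ) (x : E3) :
    curl (swirl t) x = (sc t * sc t) • curl V (sc t • x) :=
  curl_smul_comp_smul (sc t) x (hasFDerivAt_V _).differentiableAt

/-- Scaling of the model kernel: `K(t,x) = sc(t)³ G_ν(sc(t) x)`. -/
theorem backwardHeatKernel_scaling {ν : ℝ} (hν : 0 < ν) {t : ℝ} (ht : t < 0) (x : E3) :
    backwardHeatKernel ν 0 (0:E3) t x = sc t ^ 3 * heatKernel ν (sc t • x) := by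
  have hs : 0 < -t := by linarith
  rw [backwardHeatKernel_zero_eq]
  simp only [heatKernel, finrank_euclideanSpace_fin, Nat.cast_ofNat]
  have h1 : ‖sc t • x‖ ^ 2 = ‖x‖ ^ 2 / (-t) := by
    rw [norm_smul, mul_pow, Real.norm_of_nonneg (sc_pos hs).le, sq (sc t), sc_mul_sc ht]
    ring
  have h2 : (4 * Real.pi * (ν * (0 - t))) ^ (-(3:ℝ) / 2) =
      sc t ^ 3 * (4 * Real.pi * ν) ^ (-(3:ℝ) / 2) := by
    rw [show 4 * Real.pi * (ν * (0 - t)) = (4 * Real.pi * ν) * (-t) by ring,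
      Real.mul_rpow (by positivity) hs.le, mul_comm]
    congr 1
    rw [sc, inv_pow, Real.sqrt_eq_rpow, ← Real.rpow_natCast, ← Real.rpow_mul hs.le,
      ← Real.rpow_neg hs.le]
    norm_num
  rw [h1, h2]
  have h3 : -(‖x‖ ^ 2 / -t) / (4 * ν) = -‖x‖ ^ 2 / (4 * (ν * (0 - t))) := by
    field_simp
    ring
  rw [h3]
  ring

/-- The (time-independent) similarity-profile enstrophy density. -/
def F (ν : ℝ) (y : E3) : ℝ := ‖curl V y‖ ^ 2 * heatKernel ν y

/-- The profile enstrophy density is continuous. -/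
theorem continuous_F (ν : ℝ) : Continuous (F ν) :=
  ((continuous_curl (V_contDiff (n := 1))).norm.pow 2).mul (continuous_heatKernel ν)

/-- The profile enstrophy density has compact support. -/
theorem hasCompactSupport_F (ν : ℝ) : HasCompactSupport (F ν) := by
  have h1 : HasCompactSupport fun y => ‖curl V y‖ ^ 2 :=
    (hasCompactSupport_curl hasCompactSupport_V).norm.comp_left (g := fun r : ℝ => r ^ 2) (by simp)
  show HasCompactSupport ((fun y => ‖curl V y‖ ^ 2) * heatKernel ν)
  exact h1.mul_right

/-- The profile enstrophy density is nonnegative. -/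
theorem F_nonneg {ν : ℝ} (hν : 0 < ν) (y : E3) : 0 ≤ F ν y :=
  mul_nonneg (sq_nonneg _) (heatKernel_pos hν _).le

/-- The profile enstrophy density does not vanish at the origin. -/
theorem F_zero_ne {ν : ℝ} (hν : 0 < ν) : F ν 0 ≠ 0 := by
  have h1 : ‖curl V 0‖ ^ 2 = 4 := by
    rw [curl_V_zero, norm_smul, e₃, PiLp.norm_single]
    norm_num
  rw [F, h1]
  exact mul_ne_zero (by norm_num) (heatKernel_pos hν _).ne'

/-- `A = ∫ F > 0`: the profile enstrophy is positive. -/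
theorem integral_F_pos {ν : ℝ} (hν : 0 < ν) : 0 < ∫ y, F ν y :=
  (continuous_F ν).integral_pos_of_hasCompactSupport_nonneg_nonzero (hasCompactSupport_F ν)
    (F_nonneg hν) (F_zero_ne hν)

/-- **Exact power law**: the adapted enstrophy of the witness is `H(t) = A / t²`, i.e.
`A (−t)^{−2}` — constant adapted frequency `Λ ≡ 2`. -/
theorem adaptedEnstrophy_swirl {ν : ℝ} (hν : 0 < ν) {t : ℝ} (ht : t < 0) :
    (∫ x, ‖curl (swirl t) x‖ ^ 2 * backwardHeatKernel ν 0 (0:E3) t x) =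
      (∫ y, F ν y) / t ^ 2 := by
  have hsc := sc_pos (neg_pos.2 ht)
  have h1 : ∀ x, ‖curl (swirl t) x‖ ^ 2 * backwardHeatKernel ν 0 (0:E3) t x =
      sc t ^ 7 * F ν (sc t • x) := fun x => by
    rw [curl_swirl, backwardHeatKernel_scaling hν ht, norm_smul, F,
      Real.norm_of_nonneg (mul_pos hsc hsc).le]
    ring
  simp_rw [h1, integral_const_mul]
  rw [Measure.integral_comp_smul volume (F ν) (sc t)]
  simp only [finrank_euclideanSpace_fin, smul_eq_mul]
  rw [abs_of_pos (inv_pos.2 (pow_pos hsc 3)), div_eq_mul_inv, ← sc_pow_four ht]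
  field_simp

/-- The frequency clause holds for the witness with `Λ₀ = 2` (`H(t) = A/t²`, `A > 0`). -/
theorem freqClause_swirl {ν : ℝ} (hν : 0 < ν) :
    FreqClause swirl (backwardHeatKernel ν 0 (0:E3)) 2 := by
  intro H Λ hH hΛ
  set A : ℝ := ∫ y, F ν y with hA
  have hApos : 0 < A := integral_F_pos hν
  have hHt : ∀ t ∈ Iio (0:ℝ), H t = A / t ^ 2 := fun t ht => by
    rw [hH]; exact adaptedEnstrophy_swirl hν ht
  refine ⟨fun t ht => ?_, fun t ht => ?_⟩
  · rw [hHt t ht]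
    have ht0 : t ≠ 0 := ne_of_lt ht
    positivity
  · have ht0 : t ≠ 0 := ne_of_lt ht
    have hev : H =ᶠ[𝓝 t] fun s => A * (s ^ 2)⁻¹ :=
      Filter.eventuallyEq_of_mem (Iio_mem_nhds ht) fun s hs => by
        rw [hHt s hs, div_eq_mul_inv]
    have hd : HasDerivAt (fun s : ℝ => A * (s ^ 2)⁻¹) (A * (-(2 * t) / (t ^ 2) ^ 2)) t := by
      have h1 : HasDerivAt (fun s : ℝ => s ^ 2) (2 * t) t := by simpa using hasDerivAt_pow 2 t
      exact (h1.inv (pow_ne_zero 2 ht0)).const_mul A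
    rw [hΛ]
    dsimp only
    rw [hev.deriv_eq, hd.deriv, hHt t ht]
    field_simp
    ring

/-- The crux with the MOMENTUM EQUATION dropped: `v` is only required to be jointly smooth on
`(−∞,0) × ℝ³` and divergence-free (no pressure, no dynamics); everything else verbatim. -/
def FrequencyRigidityWithoutMomentum : Prop :=
  ¬ ∃ (ν C Λ₀ : ℝ) (v : ℝ → E3 → E3) (K : ℝ → E3 → ℝ), 0 < ν ∧
    IsSmoothSpaceTimeOn (Iio 0) v ∧ (∀ t ∈ Iio (0:ℝ), VectorCalculus.IsDivFree (v t)) ∧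
    TypeIBound C v ∧ KernelClauses ν v K ∧ Comparable K ∧ FreqClause v K Λ₀

/-- The variant is a strengthening of the crux. -/
theorem frequencyRigidity_of_withoutMomentum (h : FrequencyRigidityWithoutMomentum) :
    Theses.AdaptedFrequency.FrequencyRigidity := by
  rw [frequencyRigidity_iff]
  rintro ⟨ν, C, Λ₀, v, q, K, hν, hNS, hTI, hK, hC, hF⟩
  exact h ⟨ν, C, Λ₀, v, K, hν, hNS.smooth_velocity, hNS.divFree, hTI, hK, hC, hF⟩

/-- **(C)** Dropping the momentum equation makes the crux FALSE: the backward self-similar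
swirl `swirl t x = (−t)^{−1/2} V(x/√(−t))`, `V = χ · (e₃ × ·)`, is jointly smooth on
`(−∞,0) × ℝ³`, divergence-free, obeys the GLOBAL Type-I bound with `C = 2`, the backward heat
kernel is an adapted comparable kernel for it (the field is tangent to the spheres about the
pole), its adapted enstrophy is `H(t) = A/t²` with `A > 0`, so `H > 0` and `Λ ≡ 2`.
Consequently the value `Λ₀ = 2` (the self-similar equality case) is realised by the kinematics
and the kernel structure alone; only the Navier–Stokes dynamics (NRŠ/Tsai) can exclude it. -/
theorem frequencyRigidity_false_without_momentum : ¬ FrequencyRigidityWithoutMomentum := by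
  intro h
  exact h ⟨1, 2, 2, swirl, backwardHeatKernel 1 0 (0:E3), one_pos, isSmoothSpaceTimeOn_swirl,
    fun t _ => isDivFree_swirl t, typeIBound_swirl,
    kernelClauses_backwardHeatKernel one_pos _ (fun t _ x => inner_self_swirl t x),
    comparable_backwardHeatKernel one_pos, freqClause_swirl one_pos⟩


/-! ## (R) Constant frequency is NOT rigidity: the breathing two-shell swirl (gen 2)

Self-contained copy of series (R) (`Theorems/FrequencyRigidity/Negative/BreathingSwirl*.lean`),
over this file's own copies of `χ`, `V`, `rot`, `sc`, `F`, … . -/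



/-! ### Profiles, amplitudes, the breathing swirl -/

/-- Outer radial cutoff `ψ y = smoothTransition (‖y‖² − 3) · smoothTransition (8 − ‖y‖²)`:
smooth, radial, supported in the shell `3 ≤ ‖y‖² ≤ 8`, equal to `1` on `4 ≤ ‖y‖² ≤ 7`. -/
def ψ (y : E3) : ℝ := Real.smoothTransition (‖y‖ ^ 2 - 3) * Real.smoothTransition (8 - ‖y‖ ^ 2)

/-- The OUTER swirl profile `V₂ y = ψ(y) · (e₃ × y)`: smooth, supported in the shell
`3 ≤ ‖y‖² ≤ 8` (disjoint from the support `‖y‖² ≤ 2` of the inner profile `V`),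
divergence-free, tangent to the spheres about `0`, equal to `e₃ × y` on `4 ≤ ‖y‖² ≤ 7`. -/
def V₂ (y : E3) : E3 := ψ y • rot y

/-- The outer profile enstrophy density against the Gaussian `G_ν`. -/
def F₂ (ν : ℝ) (y : E3) : ℝ := ‖curl V₂ y‖ ^ 2 * heatKernel ν y

/-- Inner amplitude `a(t) = √A₂ · cos (log (−t))`, `A₂ = ∫ F₂`. -/
def amp₁ (ν t : ℝ) : ℝ := Real.sqrt (∫ y, F₂ ν y) * Real.cos (Real.log (-t))

/-- Outer amplitude `b(t) = √A₁ · sin (log (−t))`, `A₁ = ∫ F`. -/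
def amp₂ (ν t : ℝ) : ℝ := Real.sqrt (∫ y, F ν y) * Real.sin (Real.log (-t))

/-- The BREATHING PROFILE at time `t`: `W_t = a(t) V + b(t) V₂` — enstrophy is exchanged
`log`-periodically between the inner ball and the outer shell. -/
def Wb (ν t : ℝ) (y : E3) : E3 := amp₁ ν t • V y + amp₂ ν t • V₂ y

/-- **The breathing swirl** `breath ν t x = (−t)^{−1/2} W_t (x/√(−t))`. -/
def breath (ν t : ℝ) (x : E3) : E3 := sc t • Wb ν t (sc t • x)

/-- The breathing profile enstrophy density `‖curl W_t‖² G_ν`. -/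
def Fb (ν t : ℝ) (y : E3) : ℝ := ‖curl (Wb ν t) y‖ ^ 2 * heatKernel ν y

/-! ### Test points, Type-I constant, self-similarity -/

/-- The test point `y₀ = (5/2) e₁` in the shell where `V₂ = rot`. -/
def y₀ : E3 := EuclideanSpace.single 0 (5 / 2)

/-- The Type-I constant of the breathing swirl, `C_b = 2√A₂ + 3√A₁`. -/
def Cb (ν : ℝ) : ℝ := 2 * Real.sqrt (∫ y, F₂ ν y) + 3 * Real.sqrt (∫ y, F ν y)

/-- Backward self-similarity about `(0,0)`: invariance under every parabolic dilation
`v ↦ l v(l²t, l x)`, `l > 0` (Leray's backward ansatz, `pvAnsatz 0 U₀`). -/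
def IsBackwardSelfSimilar (v : ℝ → E3 → E3) : Prop :=
  ∀ l : ℝ, 0 < l → ∀ t ∈ Iio (0:ℝ), ∀ x, l • v (l ^ 2 * t) (l • x) = v t x

/-- The test point `y₁ = ½ e₁` in the inner ball where `V = rot`. -/
def y₁ : E3 := EuclideanSpace.single 0 (1 / 2)

/-! ### Normal-form vocabulary of line `kernel-fading-memory` (verbatim) -/

/-- **Centred gauge** (verbatim `KernelFadingMemory.IsCentred`): `∫ xK = 0` and `∫ vK = 0`. -/
def IsCentred (v : ℝ → E3 → E3) (K : ℝ → E3 → ℝ) : Prop :=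
  (∀ t ∈ Iio (0:ℝ), (∫ x, K t x • x) = (0 : E3)) ∧
    (∀ t ∈ Iio (0:ℝ), (∫ x, K t x • v t x) = (0 : E3))

/-- **Scale-invariant first-order bounds** (verbatim `KernelFadingMemory.HasScaleInvariantBounds`). -/
def HasScaleInvariantBounds (C' : ℝ) (v : ℝ → E3 → E3) : Prop :=
  ∀ t ∈ Iio (0:ℝ), ∀ x, ‖fderiv ℝ (v t) x‖ ≤ C' / (-t) ∧ ‖curl (v t) x‖ ≤ C' / (-t) ∧
    ‖timeDerivWithin (Iio (0:ℝ)) v t x‖ ≤ C' * (-t) ^ (-(3:ℝ) / 2)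

/-- **Rescaled kernel in backward similarity variables** (verbatim `KernelFadingMemory.simKernel`):
`K̃(s,y) = e^{−3s/2} K(−e^{−s}, e^{−s/2}y)`. -/
def simKernel (K : ℝ → E3 → ℝ) (s : ℝ) (y : E3) : ℝ :=
  Real.exp (-(3:ℝ) / 2 * s) * K (-Real.exp (-s)) (Real.exp (-s / 2) • y)

/-- **Symmetry inheritance** (verbatim `KernelFadingMemory.IsSymmetryCovariant`). -/
def IsSymmetryCovariant (v : ℝ → E3 → E3) (K : ℝ → E3 → ℝ) : Prop :=
  ∀ (c : ℝ) (R : E3 ≃ₗᵢ[ℝ] E3), 0 < c →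
    (∀ t ∈ Iio (0:ℝ), ∀ x, c • R.symm (v (c ^ 2 * t) (c • R x)) = v t x) →
      ∀ t ∈ Iio (0:ℝ), ∀ x, K t x = c ^ 3 * K (c ^ 2 * t) (c • R x)

/-- **Slaving (fading memory)** (verbatim `KernelFadingMemory.IsSlaved`). -/
def IsSlaved (κ M : ℝ) (v : ℝ → E3 → E3) (K : ℝ → E3 → ℝ) : Prop :=
  ∀ s : ℝ,
    (∫ y, |deriv (fun s' => simKernel K s' y) s|) ≤
      M * ∫ τ in Ioi (0:ℝ), Real.exp (-κ * τ) *
        ∫ y, ‖deriv (fun s' => lerayOrbit v s' y) (s + τ)‖ * (1 + ‖y‖ ^ 2) ^ 2 * simKernel K (s + τ) y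


/-! ### The outer cutoff and profile -/

/-- The outer cutoff is smooth. -/
theorem ψ_contDiff {n : ℕ∞} : ContDiff ℝ n ψ :=
  (Real.smoothTransition.contDiff.comp ((contDiff_norm_sq ℝ).sub contDiff_const)).mul
    (Real.smoothTransition.contDiff.comp (contDiff_const.sub (contDiff_norm_sq ℝ)))

/-- The outer cutoff is nonnegative. -/
theorem ψ_nonneg (y : E3) : 0 ≤ ψ y :=
  mul_nonneg (Real.smoothTransition.nonneg _) (Real.smoothTransition.nonneg _)

/-- The outer cutoff is at most `1`. -/
theorem ψ_le_one (y : E3) : ψ y ≤ 1 :=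
  mul_le_one₀ (Real.smoothTransition.le_one _) (Real.smoothTransition.nonneg _)
    (Real.smoothTransition.le_one _)

/-- The outer cutoff vanishes on `‖y‖² ≤ 3`. -/
theorem ψ_eq_zero_of_le {y : E3} (hy : ‖y‖ ^ 2 ≤ 3) : ψ y = 0 := by
  rw [ψ, Real.smoothTransition.zero_of_nonpos (by linarith), zero_mul]

/-- The outer cutoff vanishes on `‖y‖² ≥ 8`. -/
theorem ψ_eq_zero_of_ge {y : E3} (hy : 8 ≤ ‖y‖ ^ 2) : ψ y = 0 := by
  rw [ψ, Real.smoothTransition.zero_of_nonpos (x := 8 - ‖y‖ ^ 2) (by linarith), mul_zero]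

/-- The outer cutoff is `1` on `4 ≤ ‖y‖² ≤ 7`. -/
theorem ψ_eq_one {y : E3} (h1 : 4 ≤ ‖y‖ ^ 2) (h2 : ‖y‖ ^ 2 ≤ 7) : ψ y = 1 := by
  rw [ψ, Real.smoothTransition.one_of_one_le (by linarith),
    Real.smoothTransition.one_of_one_le (by linarith), mul_one]

/-- The outer cutoff is radial: its derivative kills the rotation field. -/
theorem fderiv_ψ_rot (y : E3) : fderiv ℝ ψ y (rot y) = 0 := by
  have hn : HasFDerivAt (fun y : E3 => ‖y‖ ^ 2) ((2:ℕ) • innerSL ℝ y) y :=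
    (hasStrictFDerivAt_norm_sq y).hasFDerivAt
  have h1 : HasFDerivAt (fun y : E3 => ‖y‖ ^ 2 - 3) ((2:ℕ) • innerSL ℝ y) y := hn.sub_const 3
  have h2 : HasFDerivAt (fun y : E3 => 8 - ‖y‖ ^ 2) (-((2:ℕ) • innerSL ℝ y)) y := by
    simpa using hn.const_sub (8:ℝ)
  have hs : ∀ r : ℝ, HasDerivAt Real.smoothTransition (deriv Real.smoothTransition r) r := fun r =>
    ((Real.smoothTransition.contDiff (n := 1)).differentiable (by simp) _).hasDerivAt
  have hA := (hs _).comp_hasFDerivAt y h1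
  have hB := (hs _).comp_hasFDerivAt y h2
  have h := (hA.mul hB).fderiv
  have hψ : ((Real.smoothTransition ∘ fun y : E3 => ‖y‖ ^ 2 - 3) *
      (Real.smoothTransition ∘ fun y : E3 => 8 - ‖y‖ ^ 2)) = ψ := by
    funext z; rfl
  rw [hψ] at h
  rw [h]
  simp [inner_self_rot]

/-- The outer profile is smooth. -/
theorem V₂_contDiff {n : ℕ∞} : ContDiff ℝ n V₂ := ψ_contDiff.smul rot.contDiff

/-- The outer profile vanishes on `‖y‖² ≤ 3`. -/
theorem V₂_eq_zero_of_le {y : E3} (hy : ‖y‖ ^ 2 ≤ 3) : V₂ y = 0 := by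
  simp [V₂, ψ_eq_zero_of_le hy]

/-- The outer profile vanishes on `‖y‖² ≥ 8`. -/
theorem V₂_eq_zero_of_ge {y : E3} (hy : 8 ≤ ‖y‖ ^ 2) : V₂ y = 0 := by
  simp [V₂, ψ_eq_zero_of_ge hy]

/-- The outer profile IS rigid rotation on `4 ≤ ‖y‖² ≤ 7`. -/
theorem V₂_eq_rot {y : E3} (h1 : 4 ≤ ‖y‖ ^ 2) (h2 : ‖y‖ ^ 2 ≤ 7) : V₂ y = rot y := by
  simp [V₂, ψ_eq_one h1 h2]

/-- The outer profile has compact support (in the closed ball of radius `3`). -/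
theorem hasCompactSupport_V₂ : HasCompactSupport V₂ := by
  refine HasCompactSupport.intro (isCompact_closedBall (0:E3) 3) fun y hy => V₂_eq_zero_of_ge ?_
  have h3 : 3 < ‖y‖ := by simpa [dist_eq_norm] using hy
  nlinarith

/-- The outer profile is bounded by `3`. -/
theorem norm_V₂_le (y : E3) : ‖V₂ y‖ ≤ 3 := by
  by_cases hy : 8 ≤ ‖y‖ ^ 2
  · simp [V₂_eq_zero_of_ge hy]
  · have h1 : ‖y‖ ≤ 3 := by nlinarith [norm_nonneg y]
    calc ‖V₂ y‖ = ψ y * ‖rot y‖ := by rw [V₂, norm_smul, Real.norm_of_nonneg (ψ_nonneg y)]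
      _ ≤ 1 * ‖y‖ := mul_le_mul (ψ_le_one y) (norm_rot_le y) (norm_nonneg _) zero_le_one
      _ ≤ 3 := by linarith

/-- The outer profile is tangent to the spheres about the origin. -/
theorem inner_self_V₂ (y : E3) : ⟪y, V₂ y⟫ = 0 := by
  rw [V₂, inner_smul_right, inner_self_rot, mul_zero]

/-- Product rule for the outer profile. -/
theorem hasFDerivAt_V₂ (y : E3) :
    HasFDerivAt V₂ (ψ y • rot + (fderiv ℝ ψ y).smulRight (rot y)) y :=
  ((ψ_contDiff (n := 1)).differentiable (by simp) y).hasFDerivAt.smul rot.hasFDerivAt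

/-- The outer profile is divergence-free: `div (ψ rot) = ψ tr(rot) + Dψ(rot y) = 0 + 0`. -/
theorem divergence_V₂ (y : E3) : VectorCalculus.divergence V₂ y = 0 := by
  rw [VectorCalculus.divergence, (hasFDerivAt_V₂ y).fderiv, ContinuousLinearMap.toLinearMap_add,
    map_add, ContinuousLinearMap.toLinearMap_smul, map_smul, trace_rot, smul_zero, zero_add]
  rw [show ((fderiv ℝ ψ y).smulRight (rot y) : E3 →ₗ[ℝ] E3) =
      ((fderiv ℝ ψ y : E3 →L[ℝ] ℝ) : E3 →ₗ[ℝ] ℝ).smulRight (rot y) from rfl,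
    LinearMap.trace_smulRight]
  exact fderiv_ψ_rot y

/-! ### Curl bookkeeping: disjoint supports -/

/-- `curl` only depends on the germ of the field. -/
theorem curl_congr_eventuallyEq {W₁ W₂ : E3 → E3} {y : E3} (h : W₁ =ᶠ[𝓝 y] W₂) :
    curl W₁ y = curl W₂ y := by
  simp only [curl, h.fderiv_eq]

/-- The outer profile vanishes near every point of the open ball `‖y‖² < 3`. -/
theorem V₂_eventuallyEq_zero {y : E3} (hy : ‖y‖ ^ 2 < 3) : V₂ =ᶠ[𝓝 y] fun _ => 0 := by
  have ho : IsOpen {z : E3 | ‖z‖ ^ 2 < 3} := isOpen_lt (continuous_norm.pow 2) continuous_const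
  filter_upwards [ho.mem_nhds hy] with z hz
  exact V₂_eq_zero_of_le (le_of_lt hz)

/-- The inner profile vanishes near every point of the open exterior `‖y‖² > 2`. -/
theorem V_eventuallyEq_zero {y : E3} (hy : 2 < ‖y‖ ^ 2) : V =ᶠ[𝓝 y] fun _ => 0 := by
  have ho : IsOpen {z : E3 | 2 < ‖z‖ ^ 2} := isOpen_lt continuous_const (continuous_norm.pow 2)
  filter_upwards [ho.mem_nhds hy] with z hz
  exact V_eq_zero (le_of_lt hz)

/-- The outer profile IS rigid rotation near every point of the open shell `4 < ‖y‖² < 7`. -/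
theorem V₂_eventuallyEq_rot {y : E3} (h1 : 4 < ‖y‖ ^ 2) (h2 : ‖y‖ ^ 2 < 7) :
    V₂ =ᶠ[𝓝 y] (⇑rot) := by
  have ho : IsOpen {z : E3 | 4 < ‖z‖ ^ 2 ∧ ‖z‖ ^ 2 < 7} :=
    (isOpen_lt continuous_const (continuous_norm.pow 2)).inter
      (isOpen_lt (continuous_norm.pow 2) continuous_const)
  filter_upwards [ho.mem_nhds ⟨h1, h2⟩] with z hz
  exact V₂_eq_rot hz.1.le hz.2.le

/-- The outer vorticity vanishes on the open ball `‖y‖² < 3`. -/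
theorem curl_V₂_eq_zero {y : E3} (hy : ‖y‖ ^ 2 < 3) : curl V₂ y = 0 := by
  rw [curl_congr_eventuallyEq (V₂_eventuallyEq_zero hy), curl_const]

/-- The inner vorticity vanishes on the open exterior `‖y‖² > 2`. -/
theorem curl_V_eq_zero {y : E3} (hy : 2 < ‖y‖ ^ 2) : curl V y = 0 := by
  rw [curl_congr_eventuallyEq (V_eventuallyEq_zero hy), curl_const]

/-- `‖y₀‖² = 25/4`. -/
theorem norm_y₀_sq : ‖y₀‖ ^ 2 = 25 / 4 := by
  rw [y₀, PiLp.norm_single, Real.norm_eq_abs, abs_of_pos (by norm_num)]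
  norm_num

/-- At `y₀` the outer vorticity is `2e₃`. -/
theorem curl_V₂_y₀ : curl V₂ y₀ = (2:ℝ) • e₃ := by
  rw [curl_congr_eventuallyEq (V₂_eventuallyEq_rot (y := y₀) (by rw [norm_y₀_sq]; norm_num)
    (by rw [norm_y₀_sq]; norm_num)), curl_rot]

/-! ### The breathing profile: derivative, curl, divergence -/

/-- Derivative of the breathing profile. -/
theorem hasFDerivAt_Wb (ν t : ℝ) (y : E3) :
    HasFDerivAt (Wb ν t) (amp₁ ν t • (χ y • rot + (fderiv ℝ χ y).smulRight (rot y)) +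
      amp₂ ν t • (ψ y • rot + (fderiv ℝ ψ y).smulRight (rot y))) y := by
  have h : Wb ν t = amp₁ ν t • V + amp₂ ν t • V₂ := by funext z; rfl
  rw [h]
  exact ((hasFDerivAt_V y).const_smul _).add ((hasFDerivAt_V₂ y).const_smul _)

/-- The breathing profile is smooth in space. -/
theorem Wb_contDiff (ν t : ℝ) {n : ℕ∞} : ContDiff ℝ n (Wb ν t) := by
  show ContDiff ℝ n (fun y => amp₁ ν t • V y + amp₂ ν t • V₂ y)
  exact (V_contDiff.const_smul _).add (V₂_contDiff.const_smul _)

/-- `curl W_t = a(t) curl V + b(t) curl V₂`. -/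
theorem curl_Wb (ν t : ℝ) (y : E3) :
    curl (Wb ν t) y = amp₁ ν t • curl V y + amp₂ ν t • curl V₂ y := by
  simp only [curl, (hasFDerivAt_Wb ν t y).fderiv, (hasFDerivAt_V y).fderiv, (hasFDerivAt_V₂ y).fderiv]
  ext i
  fin_cases i <;> simp [mul_sub] <;> ring

/-- Pointwise Pythagoras (disjoint supports): `‖curl W_t‖² = a² ‖curl V‖² + b² ‖curl V₂‖²`. -/
theorem norm_curl_Wb_sq (ν t : ℝ) (y : E3) :
    ‖curl (Wb ν t) y‖ ^ 2 = amp₁ ν t ^ 2 * ‖curl V y‖ ^ 2 + amp₂ ν t ^ 2 * ‖curl V₂ y‖ ^ 2 := by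
  rw [curl_Wb]
  rcases lt_or_ge (‖y‖ ^ 2) 3 with h | h
  · rw [curl_V₂_eq_zero h]
    simp [norm_smul, mul_pow]
  · rw [curl_V_eq_zero (by linarith)]
    simp [norm_smul, mul_pow]

/-- The breathing profile is divergence-free. -/
theorem divergence_Wb (ν t : ℝ) (y : E3) : VectorCalculus.divergence (Wb ν t) y = 0 := by
  have h1 := divergence_V y
  have h2 := divergence_V₂ y
  rw [VectorCalculus.divergence, (hasFDerivAt_V y).fderiv] at h1
  rw [VectorCalculus.divergence, (hasFDerivAt_V₂ y).fderiv] at h2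
  rw [VectorCalculus.divergence, (hasFDerivAt_Wb ν t y).fderiv, ContinuousLinearMap.toLinearMap_add,
    map_add, ContinuousLinearMap.toLinearMap_smul, map_smul, ContinuousLinearMap.toLinearMap_smul,
    map_smul, h1, h2, smul_zero, smul_zero, add_zero]

/-- The breathing profile is bounded: `‖W_t y‖ ≤ 2|a(t)| + 3|b(t)|`. -/
theorem norm_Wb_le (ν t : ℝ) (y : E3) : ‖Wb ν t y‖ ≤ 2 * |amp₁ ν t| + 3 * |amp₂ ν t| := by
  calc ‖Wb ν t y‖ ≤ ‖amp₁ ν t • V y‖ + ‖amp₂ ν t • V₂ y‖ := norm_add_le _ _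
    _ = |amp₁ ν t| * ‖V y‖ + |amp₂ ν t| * ‖V₂ y‖ := by
        rw [norm_smul, norm_smul, Real.norm_eq_abs, Real.norm_eq_abs]
    _ ≤ |amp₁ ν t| * 2 + |amp₂ ν t| * 3 :=
        add_le_add (mul_le_mul_of_nonneg_left (norm_V_le y) (abs_nonneg _))
          (mul_le_mul_of_nonneg_left (norm_V₂_le y) (abs_nonneg _))
    _ = 2 * |amp₁ ν t| + 3 * |amp₂ ν t| := by ring

/-- The breathing profile is tangent to the spheres about the origin. -/
theorem inner_self_Wb (ν t : ℝ) (y : E3) : ⟪y, Wb ν t y⟫ = 0 := by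
  rw [Wb, inner_add_right, inner_smul_right, inner_smul_right, inner_self_V, inner_self_V₂]
  ring

/-- The breathing profile is odd. -/
theorem Wb_neg (ν t : ℝ) (y : E3) : Wb ν t (-y) = -Wb ν t y := by
  have hχ : χ (-y) = χ y := by simp [χ, norm_neg]
  have hψ : ψ (-y) = ψ y := by simp [ψ, norm_neg]
  simp only [Wb, V, V₂, hχ, hψ, map_neg, smul_neg, neg_add]


/-! ### The breathing swirl: kinematics -/

/-- `|a(t)| ≤ √A₂`. -/
theorem abs_amp₁_le (ν t : ℝ) : |amp₁ ν t| ≤ Real.sqrt (∫ y, F₂ ν y) := by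
  rw [amp₁, abs_mul, abs_of_nonneg (Real.sqrt_nonneg _)]
  exact mul_le_of_le_one_right (Real.sqrt_nonneg _) (Real.abs_cos_le_one _)

/-- `|b(t)| ≤ √A₁`. -/
theorem abs_amp₂_le (ν t : ℝ) : |amp₂ ν t| ≤ Real.sqrt (∫ y, F ν y) := by
  rw [amp₂, abs_mul, abs_of_nonneg (Real.sqrt_nonneg _)]
  exact mul_le_of_le_one_right (Real.sqrt_nonneg _) (Real.abs_sin_le_one _)

/-- The breathing swirl is jointly smooth on `(−∞,0) × ℝ³`. -/
theorem isSmoothSpaceTimeOn_breath (ν : ℝ) : IsSmoothSpaceTimeOn (Iio 0) (breath ν) := by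
  rintro ⟨t, x⟩ ⟨ht, -⟩
  apply ContDiffAt.contDiffWithinAt
  have ht' : t < 0 := ht
  have hsc : ContDiffAt ℝ ∞ (fun p : ℝ × E3 => sc p.1) (t, x) :=
    ContDiffAt.comp (t, x) (g := sc) (f := Prod.fst) (sc_contDiffAt ht') contDiffAt_fst
  have hlog : ContDiffAt ℝ ∞ (fun p : ℝ × E3 => Real.log (-p.1)) (t, x) :=
    (Real.contDiffAt_log.2 (by linarith : -t ≠ 0)).comp (t, x) contDiffAt_fst.neg
  have ha : ContDiffAt ℝ ∞ (fun p : ℝ × E3 => amp₁ ν p.1) (t, x) := contDiffAt_const.mul hlog.cos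
  have hb : ContDiffAt ℝ ∞ (fun p : ℝ × E3 => amp₂ ν p.1) (t, x) := contDiffAt_const.mul hlog.sin
  have hy : ContDiffAt ℝ ∞ (fun p : ℝ × E3 => sc p.1 • p.2) (t, x) := hsc.smul contDiffAt_snd
  have hV : ContDiffAt ℝ ∞ (fun p : ℝ × E3 => V (sc p.1 • p.2)) (t, x) :=
    (V_contDiff (n := ⊤)).contDiffAt.comp (t, x) hy
  have hV₂ : ContDiffAt ℝ ∞ (fun p : ℝ × E3 => V₂ (sc p.1 • p.2)) (t, x) :=
    (V₂_contDiff (n := ⊤)).contDiffAt.comp (t, x) hy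
  exact hsc.smul ((ha.smul hV).add (hb.smul hV₂))

/-- The breathing swirl is divergence-free at every time. -/
theorem isDivFree_breath (ν t : ℝ) : VectorCalculus.IsDivFree (breath ν t) := by
  intro x
  show VectorCalculus.divergence (fun z => sc t • Wb ν t (sc t • z)) x = 0
  rw [divergence_smul_comp_smul _ _ (hasFDerivAt_Wb ν t _).differentiableAt, divergence_Wb,
    mul_zero]

/-- The breathing swirl obeys the GLOBAL Type-I bound with constant `C_b`. -/
theorem typeIBound_breath (ν : ℝ) : TypeIBound (Cb ν) (breath ν) := by
  intro t ht x
  have hsc := sc_pos (neg_pos.2 (show t < 0 from ht))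
  rw [breath, norm_smul, Real.norm_of_nonneg hsc.le, sc, div_eq_mul_inv, mul_comm]
  refine mul_le_mul_of_nonneg_right ((norm_Wb_le ν t _).trans ?_) (inv_nonneg.2 (Real.sqrt_nonneg _))
  have h1 := abs_amp₁_le ν t
  have h2 := abs_amp₂_le ν t
  rw [Cb]
  linarith

/-- The breathing swirl is tangent to the spheres about the origin. -/
theorem inner_self_breath (ν t : ℝ) (x : E3) : ⟪x, breath ν t x⟫ = 0 := by
  rw [breath, inner_smul_right]
  rcases eq_or_ne (sc t) 0 with h | h
  · simp [h]
  · have := inner_self_Wb ν t (sc t • x)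
    rw [inner_smul_left] at this
    simp only [conj_trivial, mul_eq_zero, h, false_or] at this
    rw [this, mul_zero]

/-- The breathing swirl is odd in space. -/
theorem breath_neg (ν t : ℝ) (x : E3) : breath ν t (-x) = -breath ν t x := by
  rw [breath, breath, smul_neg, Wb_neg, smul_neg]

/-- Scaling of the vorticity: `curl (breath t)(x) = (−t)⁻¹ (curl W_t)(x/√(−t))`. -/
theorem curl_breath (ν t : ℝ) (x : E3) :
    curl (breath ν t) x = (sc t * sc t) • curl (Wb ν t) (sc t • x) :=
  curl_smul_comp_smul (sc t) x (hasFDerivAt_Wb ν t _).differentiableAt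

/-! ### The breathing swirl: exact power-law enstrophy `H = A₁A₂/t²`, `Λ ≡ 2` -/

/-- The inner profile enstrophy density is integrable. -/
theorem integrable_F (ν : ℝ) : Integrable (F ν) :=
  (continuous_F ν).integrable_of_hasCompactSupport (hasCompactSupport_F ν)

/-- The outer profile enstrophy density is continuous. -/
theorem continuous_F₂ (ν : ℝ) : Continuous (F₂ ν) :=
  ((continuous_curl (V₂_contDiff (n := 1))).norm.pow 2).mul (continuous_heatKernel ν)

/-- The outer profile enstrophy density has compact support. -/
theorem hasCompactSupport_F₂ (ν : ℝ) : HasCompactSupport (F₂ ν) := by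
  have h1 : HasCompactSupport fun y => ‖curl V₂ y‖ ^ 2 :=
    (hasCompactSupport_curl hasCompactSupport_V₂).norm.comp_left (g := fun r : ℝ => r ^ 2) (by simp)
  show HasCompactSupport ((fun y => ‖curl V₂ y‖ ^ 2) * heatKernel ν)
  exact h1.mul_right

/-- The outer profile enstrophy density is integrable. -/
theorem integrable_F₂ (ν : ℝ) : Integrable (F₂ ν) :=
  (continuous_F₂ ν).integrable_of_hasCompactSupport (hasCompactSupport_F₂ ν)

/-- The outer profile enstrophy density is nonnegative. -/
theorem F₂_nonneg {ν : ℝ} (hν : 0 < ν) (y : E3) : 0 ≤ F₂ ν y :=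
  mul_nonneg (sq_nonneg _) (heatKernel_pos hν _).le

/-- The outer profile enstrophy density does not vanish at `y₀`. -/
theorem F₂_y₀_ne {ν : ℝ} (hν : 0 < ν) : F₂ ν y₀ ≠ 0 := by
  have h1 : ‖curl V₂ y₀‖ ^ 2 = 4 := by
    rw [curl_V₂_y₀, norm_smul, e₃, PiLp.norm_single]
    norm_num
  rw [F₂, h1]
  exact mul_ne_zero (by norm_num) (heatKernel_pos hν _).ne'

/-- `A₂ = ∫ F₂ > 0`: the outer profile enstrophy is positive. -/
theorem integral_F₂_pos {ν : ℝ} (hν : 0 < ν) : 0 < ∫ y, F₂ ν y :=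
  (continuous_F₂ ν).integral_pos_of_hasCompactSupport_nonneg_nonzero (hasCompactSupport_F₂ ν)
    (F₂_nonneg hν) (F₂_y₀_ne hν)

/-- The breathing profile enstrophy density splits. -/
theorem Fb_eq (ν t : ℝ) (y : E3) : Fb ν t y = amp₁ ν t ^ 2 * F ν y + amp₂ ν t ^ 2 * F₂ ν y := by
  rw [Fb, norm_curl_Wb_sq, F, F₂]
  ring

/-- … and so does its integral. -/
theorem integral_Fb (ν t : ℝ) :
    ∫ y, Fb ν t y = amp₁ ν t ^ 2 * (∫ y, F ν y) + amp₂ ν t ^ 2 * (∫ y, F₂ ν y) := by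
  simp_rw [Fb_eq]
  rw [integral_add ((integrable_F ν).const_mul _) ((integrable_F₂ ν).const_mul _),
    integral_const_mul, integral_const_mul]

/-- `a(t)² A₁ + b(t)² A₂ = A₁ A₂` (`cos² + sin² = 1`): the profile enstrophy is CONSTANT in `t`. -/
theorem amp_sq_combination {ν : ℝ} (hν : 0 < ν) (t : ℝ) :
    amp₁ ν t ^ 2 * (∫ y, F ν y) + amp₂ ν t ^ 2 * (∫ y, F₂ ν y) = (∫ y, F ν y) * (∫ y, F₂ ν y) := by
  rw [amp₁, amp₂, mul_pow, mul_pow, Real.sq_sqrt (integral_F₂_pos hν).le,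
    Real.sq_sqrt (integral_F_pos hν).le]
  linear_combination (∫ y, F ν y) * (∫ y, F₂ ν y) * Real.cos_sq_add_sin_sq (Real.log (-t))

/-- **Exact power law**: the adapted enstrophy of the breathing swirl against the backward heat
kernel is `H(t) = A₁A₂ / t²` — constant adapted frequency `Λ ≡ 2`, although the profile `W_t`
is NOT constant in `t`. -/
theorem adaptedEnstrophy_breath {ν : ℝ} (hν : 0 < ν) {t : ℝ} (ht : t < 0) :
    (∫ x, ‖curl (breath ν t) x‖ ^ 2 * backwardHeatKernel ν 0 (0:E3) t x) =
      ((∫ y, F ν y) * (∫ y, F₂ ν y)) / t ^ 2 := by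
  have hsc := sc_pos (neg_pos.2 ht)
  have h1 : ∀ x, ‖curl (breath ν t) x‖ ^ 2 * backwardHeatKernel ν 0 (0:E3) t x =
      sc t ^ 7 * Fb ν t (sc t • x) := fun x => by
    rw [curl_breath, backwardHeatKernel_scaling hν ht, norm_smul, Fb,
      Real.norm_of_nonneg (mul_pos hsc hsc).le]
    ring
  simp_rw [h1, integral_const_mul]
  rw [Measure.integral_comp_smul volume (Fb ν t) (sc t)]
  simp only [finrank_euclideanSpace_fin, smul_eq_mul]
  rw [abs_of_pos (inv_pos.2 (pow_pos hsc 3)), integral_Fb, amp_sq_combination hν,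
    div_eq_mul_inv, ← sc_pow_four ht]
  field_simp

/-- The frequency clause holds for the breathing swirl with `Λ₀ = 2` (`H = A₁A₂/t²`, `A₁A₂ > 0`). -/
theorem freqClause_breath {ν : ℝ} (hν : 0 < ν) :
    FreqClause (breath ν) (backwardHeatKernel ν 0 (0:E3)) 2 := by
  intro H Λ hH hΛ
  set A : ℝ := (∫ y, F ν y) * (∫ y, F₂ ν y) with hA
  have hApos : 0 < A := mul_pos (integral_F_pos hν) (integral_F₂_pos hν)
  have hHt : ∀ t ∈ Iio (0:ℝ), H t = A / t ^ 2 := fun t ht => by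
    rw [hH]; exact adaptedEnstrophy_breath hν ht
  refine ⟨fun t ht => ?_, fun t ht => ?_⟩
  · rw [hHt t ht]
    have ht0 : t ≠ 0 := ne_of_lt ht
    positivity
  · have ht0 : t ≠ 0 := ne_of_lt ht
    have hev : H =ᶠ[𝓝 t] fun s => A * (s ^ 2)⁻¹ :=
      Filter.eventuallyEq_of_mem (Iio_mem_nhds ht) fun s hs => by
        rw [hHt s hs, div_eq_mul_inv]
    have hd : HasDerivAt (fun s : ℝ => A * (s ^ 2)⁻¹) (A * (-(2 * t) / (t ^ 2) ^ 2)) t := by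
      have h1 : HasDerivAt (fun s : ℝ => s ^ 2) (2 * t) t := by simpa using hasDerivAt_pow 2 t
      exact (h1.inv (pow_ne_zero 2 ht0)).const_mul A
    rw [hΛ]
    dsimp only
    rw [hev.deriv_eq, hd.deriv, hHt t ht]
    field_simp
    ring

/-- **(R, inhabitant)** The breathing swirl inhabits the `∃`-body of the crux with the momentum
equation dropped (`FrequencyRigidityWithoutMomentum` of (C)): jointly smooth, divergence-free,
GLOBAL Type-I, heat kernel adapted and comparable, `H > 0`, `Λ ≡ 2`. -/
theorem breath_inhabits_withoutMomentum {ν : ℝ} (hν : 0 < ν) :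
    IsSmoothSpaceTimeOn (Iio 0) (breath ν) ∧ (∀ t ∈ Iio (0:ℝ), VectorCalculus.IsDivFree (breath ν t)) ∧
      TypeIBound (Cb ν) (breath ν) ∧ KernelClauses ν (breath ν) (backwardHeatKernel ν 0 (0:E3)) ∧
      Comparable (backwardHeatKernel ν 0 (0:E3)) ∧ FreqClause (breath ν) (backwardHeatKernel ν 0 (0:E3)) 2 :=
  ⟨isSmoothSpaceTimeOn_breath ν, fun t _ => isDivFree_breath ν t, typeIBound_breath ν,
    kernelClauses_backwardHeatKernel hν _ (fun t _ x => inner_self_breath ν t x),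
    comparable_backwardHeatKernel hν, freqClause_breath hν⟩


/-! ### (R) Non-rigidity: the breathing swirl is neither self-similar nor a rotating wave -/

/-- Parabolic dilation of the similarity factor: `sc(l²t) = sc(t)/l`. -/
theorem sc_dilate {l : ℝ} (hl : 0 < l) (t : ℝ) : sc (l ^ 2 * t) = l⁻¹ * sc t := by
  rw [sc, sc, show -(l ^ 2 * t) = l ^ 2 * (-t) by ring, Real.sqrt_mul (sq_nonneg l),
    Real.sqrt_sq hl.le, mul_inv]

/-- Parabolic dilation of the breathing swirl only shifts the phase of the profile:
`l · breath(l²t, l x) = sc(t) W_{l²t}(sc(t) x)`. -/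
theorem dilate_breath (ν : ℝ) {l : ℝ} (hl : 0 < l) (t : ℝ) (x : E3) :
    l • breath ν (l ^ 2 * t) (l • x) = sc t • Wb ν (l ^ 2 * t) (sc t • x) := by
  rw [breath, sc_dilate hl t, smul_smul, smul_smul,
    show l * (l⁻¹ * sc t) = sc t by field_simp, show l⁻¹ * sc t * l = sc t by field_simp]

/-- `log (−(e^{θ})² t) = log (−t) + 2θ`. -/
theorem log_neg_exp_sq_mul (θ : ℝ) {t : ℝ} (ht : t < 0) :
    Real.log (-(Real.exp θ ^ 2 * t)) = Real.log (-t) + 2 * θ := by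
  rw [show -(Real.exp θ ^ 2 * t) = Real.exp θ ^ 2 * (-t) by ring,
    Real.log_mul (by positivity) (by linarith), Real.log_pow, Real.log_exp]
  push_cast
  ring

/-- A HALF TURN of phase flips the profile: `W_{(e^{π/2})² t} = −W_t`. -/
theorem Wb_halfTurn (ν : ℝ) {t : ℝ} (ht : t < 0) (y : E3) :
    Wb ν (Real.exp (Real.pi / 2) ^ 2 * t) y = -Wb ν t y := by
  have hl := log_neg_exp_sq_mul (Real.pi / 2) ht
  rw [show 2 * (Real.pi / 2) = Real.pi by ring] at hl
  simp only [Wb, amp₁, amp₂, hl, Real.cos_add_pi, Real.sin_add_pi]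
  simp only [mul_neg, neg_smul, neg_add]

/-- A FULL TURN of phase is a symmetry: `W_{(e^{π})² t} = W_t`. -/
theorem Wb_fullTurn (ν : ℝ) {t : ℝ} (ht : t < 0) (y : E3) :
    Wb ν (Real.exp Real.pi ^ 2 * t) y = Wb ν t y := by
  have hl := log_neg_exp_sq_mul Real.pi ht
  rw [show Real.log (-t) + 2 * Real.pi = Real.log (-t) + ((1:ℕ) : ℝ) * (2 * Real.pi) by
    push_cast; ring] at hl
  simp only [Wb, amp₁, amp₂, hl, Real.cos_add_nat_mul_two_pi, Real.sin_add_nat_mul_two_pi]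

/-- **The breathing swirl is DISCRETELY self-similar with factor `e^{π}`** … -/
theorem breath_dss (ν : ℝ) {t : ℝ} (ht : t < 0) (x : E3) :
    Real.exp Real.pi • breath ν (Real.exp Real.pi ^ 2 * t) (Real.exp Real.pi • x) = breath ν t x := by
  rw [dilate_breath ν (Real.exp_pos _), Wb_fullTurn ν ht, breath]

/-- … and ANTI-self-similar under the half factor `e^{π/2}`: `l · breath(l²t, l x) = −breath(t,x)`. -/
theorem breath_halfTurn (ν : ℝ) {t : ℝ} (ht : t < 0) (x : E3) :
    Real.exp (Real.pi / 2) • breath ν (Real.exp (Real.pi / 2) ^ 2 * t) (Real.exp (Real.pi / 2) • x) =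
      -breath ν t x := by
  rw [dilate_breath ν (Real.exp_pos _), Wb_halfTurn ν ht, smul_neg, breath]

/-- `‖y₁‖² = 1/4`. -/
theorem norm_y₁_sq : ‖y₁‖ ^ 2 = 1 / 4 := by
  rw [y₁, PiLp.norm_single, Real.norm_eq_abs, abs_of_pos (by norm_num)]
  norm_num

/-- `rot y₁ ≠ 0`. -/
theorem rot_y₁_ne : rot y₁ ≠ 0 := by
  intro h
  have h1 := congrArg (fun z : E3 => z 1) h
  simp [y₁] at h1

/-- `rot y₀ ≠ 0`. -/
theorem rot_y₀_ne : rot y₀ ≠ 0 := by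
  intro h
  have h1 := congrArg (fun z : E3 => z 1) h
  simp [y₀] at h1

/-- At `t = −1` the breathing swirl is the inner swirl: `breath(−1) = √A₂ · V`. -/
theorem breath_neg_one (ν : ℝ) (x : E3) : breath ν (-1) x = Real.sqrt (∫ y, F₂ ν y) • V x := by
  simp [breath, sc, Wb, amp₁, amp₂]

/-- At `t = −e^{π/2}` the breathing swirl is the outer swirl: `breath = sc · √A₁ · V₂(sc ·)`. -/
theorem breath_quarterTurn (ν : ℝ) (x : E3) :
    breath ν (-Real.exp (Real.pi / 2)) x =
      sc (-Real.exp (Real.pi / 2)) • (Real.sqrt (∫ y, F ν y) • V₂ (sc (-Real.exp (Real.pi / 2)) • x)) := by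
  simp [breath, Wb, amp₁, amp₂, Real.log_exp]

/-- **(R1) The breathing swirl is NOT backward self-similar** (the half-turn dilation flips its
sign, and it does not vanish at `(−1, y₁)`). -/
theorem breath_not_selfSimilar {ν : ℝ} (hν : 0 < ν) : ¬ IsBackwardSelfSimilar (breath ν) := by
  intro h
  have h1 := h (Real.exp (Real.pi / 2)) (Real.exp_pos _) (-1) (by norm_num) y₁
  rw [breath_halfTurn ν (by norm_num) y₁, breath_neg_one] at h1
  have hV : V y₁ = rot y₁ := by simp [V, χ_eq_one (y := y₁) (by rw [norm_y₁_sq]; norm_num)]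
  rw [hV] at h1
  have h2 : (2 * Real.sqrt (∫ y, F₂ ν y)) • rot y₁ = 0 := by
    rw [mul_smul, two_smul]
    nth_rewrite 1 [← h1]
    exact neg_add_cancel _
  rcases smul_eq_zero.1 h2 with h3 | h3
  · have := Real.sqrt_pos.2 (integral_F₂_pos hν)
    linarith
  · exact rot_y₁_ne h3

/-- `rotZ θ 0 = 0`. -/
theorem rotZ_zero_vec' (θ : ℝ) : rotZ θ (0 : E3) = 0 := by
  ext i
  fin_cases i <;> simp

/-- **(R2) The breathing swirl is NOT a rotating wave** `pvAnsatz α U₀` for ANY rotation speed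
`α` and ANY profile `U₀` (Pineau–Vicol's backward rotated self-similar ansatz; `α = 0` is
Leray's): at `t = −1` the ansatz forces `U₀ = √A₂ V`, supported in `‖y‖² ≤ 2`, but at
`t = −e^{π/2}` the swirl lives in the outer shell. -/
theorem breath_not_rotatingWave {ν : ℝ} (hν : 0 < ν) (α : ℝ) (U₀ : E3 → E3) :
    ¬ ∀ t ∈ Iio (0:ℝ), ∀ x, breath ν t x = pvAnsatz α (fun y _ => U₀ y) t x := by
  intro h
  have hU : ∀ x, U₀ x = Real.sqrt (∫ y, F₂ ν y) • V x := fun x => by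
    have h1 := h (-1) (by norm_num) x
    rw [breath_neg_one] at h1
    simpa [pvAnsatz] using h1.symm
  set t₂ : ℝ := -Real.exp (Real.pi / 2) with ht₂
  have ht₂0 : t₂ < 0 := neg_lt_zero.2 (Real.exp_pos _)
  have hsc := sc_pos (neg_pos.2 ht₂0)
  set x₂ : E3 := (sc t₂)⁻¹ • y₀ with hx₂
  have hy : sc t₂ • x₂ = y₀ := by rw [hx₂, smul_smul, mul_inv_cancel₀ hsc.ne', one_smul]
  have h2 := h t₂ ht₂0 x₂
  -- left-hand side: the outer swirl, non-zero
  have hL : breath ν t₂ x₂ = (sc t₂ * Real.sqrt (∫ y, F ν y)) • rot y₀ := by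
    rw [ht₂, breath_quarterTurn, ← ht₂, hy, V₂_eq_rot (by rw [norm_y₀_sq]; norm_num)
      (by rw [norm_y₀_sq]; norm_num), smul_smul]
  -- right-hand side: the rotated inner swirl evaluated in the outer shell, zero
  have hR : pvAnsatz α (fun y _ => U₀ y) t₂ x₂ = 0 := by
    have hsc' : (Real.sqrt (-t₂))⁻¹ = sc t₂ := rfl
    simp only [pvAnsatz, hsc', hy, hU]
    rw [V_eq_zero (by rw [norm_rotZ, norm_y₀_sq]; norm_num), smul_zero, rotZ_zero_vec', smul_zero]
  rw [hL, hR] at h2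
  rcases smul_eq_zero.1 h2 with h3 | h3
  · have := Real.sqrt_pos.2 (integral_F_pos hν)
    have := mul_pos hsc this
    linarith
  · exact rot_y₀_ne h3

/-! ### Generic helpers used by file 5 (odd integrals, the model kernel is even, `sc` calculus) -/

/-- The Bochner integral of an odd `ℝ³`-valued function on `ℝ³` vanishes. -/
theorem integral_eq_zero_of_odd {f : E3 → E3} (hf : ∀ x, f (-x) = -f x) : ∫ x, f x = 0 := by
  set I : E3 := ∫ x, f x with hI
  have hneg : I = -I := by
    calc I = ∫ x, f (-x) := (integral_neg_eq_self f volume).symm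
      _ = ∫ x, -f x := by congr 1; funext x; exact hf x
      _ = -I := by rw [integral_neg]
  have h2 : (2:ℝ) • I = 0 := by rw [two_smul]; nth_rewrite 2 [hneg]; exact add_neg_cancel I
  exact (smul_eq_zero.1 h2).resolve_left two_ne_zero

/-- The model kernel is even in space. -/
theorem backwardHeatKernel_neg (ν t : ℝ) (x : E3) :
    backwardHeatKernel ν 0 (0:E3) t (-x) = backwardHeatKernel ν 0 (0:E3) t x := by
  simp [backwardHeatKernel, heatKernel_neg]

/-- `sc(t)³ = (−t)^{−3/2}`. -/
theorem sc_pow_three {t : ℝ} (ht : t < 0) : sc t ^ 3 = (-t) ^ (-(3:ℝ) / 2) := by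
  have hs : 0 < -t := by linarith
  rw [sc, inv_pow, Real.sqrt_eq_rpow, ← Real.rpow_natCast, ← Real.rpow_mul hs.le,
    ← Real.rpow_neg hs.le]
  norm_num

/-- `d/dt sc(t) = sc(t)³/2` for `t < 0`. -/
theorem hasDerivAt_sc {t : ℝ} (ht : t < 0) : HasDerivAt sc (sc t ^ 3 / 2) t := by
  have hs : 0 < -t := by linarith
  have hsq : Real.sqrt (-t) ≠ 0 := Real.sqrt_ne_zero'.2 hs
  have h1 : HasDerivAt (fun s : ℝ => Real.sqrt (-s)) (1 / (2 * Real.sqrt (-t)) * (-1)) t :=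
    (Real.hasDerivAt_sqrt (by linarith : -t ≠ 0)).comp t (hasDerivAt_neg t)
  have h2 : HasDerivAt sc (-(1 / (2 * Real.sqrt (-t)) * (-1)) / Real.sqrt (-t) ^ 2) t := h1.inv hsq
  refine h2.congr_deriv ?_
  rw [sc]
  field_simp

/-- `d/dt log(−t) = t⁻¹` for `t < 0`. -/
theorem hasDerivAt_log_neg {t : ℝ} (ht : t < 0) : HasDerivAt (fun s : ℝ => Real.log (-s)) t⁻¹ t := by
  have h := (Real.hasDerivAt_log (by linarith : -t ≠ 0)).comp t (hasDerivAt_neg t)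
  refine h.congr_deriv ?_
  rw [inv_neg]
  ring


/-! ### (R3) The normal-form clauses of line `kernel-fading-memory` hold KINEMATICALLY

Verbatim vocabulary of `Cruxes/FrequencyRigidity/Lines/kernel-fading-memory.lean` (namespace
`…Cruxes.FrequencyRigidity.KernelFadingMemory`; restated here because a `Theorems/` file cannot
import a skeleton): `IsCentred`, `HasScaleInvariantBounds`, `simKernel`, `IsSymmetryCovariant`,
`IsSlaved`.  For the breathing swirl with the backward heat kernel ALL of them hold — the kernel
is even STEADY in similarity variables — so together with (R1)/(R2) every field of that line's
`IsCanonicalWitness` except `ns` (Navier–Stokes) and `unique` (the line's own Harris lever) is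
inhabited by a non-self-similar, non-rotating configuration with `Λ ≡ 2`. -/

/-- **The breathing swirl is CENTRED** with respect to the heat kernel (both integrands are odd):
in the line's canonical Galilei gauge there is no wobble freedom left, and the field is still
not self-similar. -/
theorem isCentred_breath (ν : ℝ) : IsCentred (breath ν) (backwardHeatKernel ν 0 (0:E3)) := by
  refine ⟨fun t _ => integral_eq_zero_of_odd fun x => ?_, fun t _ => integral_eq_zero_of_odd fun x => ?_⟩
  · rw [backwardHeatKernel_neg, smul_neg]
  · rw [backwardHeatKernel_neg, breath_neg, smul_neg]

/-- In similarity variables the backward heat kernel is the STEADY Gaussian `G_ν`. -/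
theorem simKernel_backwardHeatKernel {ν : ℝ} (hν : 0 < ν) (s : ℝ) (y : E3) :
    simKernel (backwardHeatKernel ν 0 (0:E3)) s y = heatKernel ν y := by
  have ht : -Real.exp (-s) < 0 := neg_lt_zero.2 (Real.exp_pos _)
  rw [simKernel, backwardHeatKernel_eq hν.le (0:E3) ht]
  simp only [finrank_euclideanSpace_fin, Nat.cast_ofNat, sub_zero, sub_neg_eq_add, zero_add,
    heatKernel]
  have h1 : (Real.exp (-s)) ^ (-(3:ℝ) / 2) = Real.exp ((3:ℝ) / 2 * s) := by
    rw [← Real.exp_mul]; congr 1; ring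
  have h2 : ‖Real.exp (-s / 2) • y‖ ^ 2 = Real.exp (-s) * ‖y‖ ^ 2 := by
    rw [norm_smul, Real.norm_of_nonneg (Real.exp_pos _).le, mul_pow, sq (Real.exp (-s / 2)),
      ← Real.exp_add]
    congr 2; ring
  have h3 : -(Real.exp (-s) * ‖y‖ ^ 2) / (4 * ν * Real.exp (-s)) = -‖y‖ ^ 2 / (4 * ν) := by
    field_simp
  have h4 : Real.exp (-(3:ℝ) / 2 * s) * Real.exp ((3:ℝ) / 2 * s) = 1 := by
    rw [← Real.exp_add]; convert Real.exp_zero using 2; ring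
  rw [h1, h2, h3]
  calc Real.exp (-(3:ℝ) / 2 * s) *
        ((4 * Real.pi * ν) ^ (-(3:ℝ) / 2) * Real.exp ((3:ℝ) / 2 * s) * Real.exp (-‖y‖ ^ 2 / (4 * ν)))
      = (Real.exp (-(3:ℝ) / 2 * s) * Real.exp ((3:ℝ) / 2 * s)) *
          ((4 * Real.pi * ν) ^ (-(3:ℝ) / 2) * Real.exp (-‖y‖ ^ 2 / (4 * ν))) := by ring
    _ = (4 * Real.pi * ν) ^ (-(3:ℝ) / 2) * Real.exp (-‖y‖ ^ 2 / (4 * ν)) := by rw [h4, one_mul]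

/-- **The breathing swirl is SLAVED for every rate `κ` and every `M ≥ 0`** — trivially: its
canonical kernel is steady in similarity variables (`∂ₛK̃ ≡ 0`) while its profile is not
(`∂ₛU ≢ 0`).  So slaving (kernel speed ≤ future unsteadiness of the flow) carries no converse
information: an unsteady flow may well have a steady kernel. -/
theorem isSlaved_breath {ν : ℝ} (hν : 0 < ν) (κ : ℝ) {M : ℝ} (hM : 0 ≤ M) :
    IsSlaved κ M (breath ν) (backwardHeatKernel ν 0 (0:E3)) := by
  intro s
  have h0 : ∀ y, deriv (fun s' => simKernel (backwardHeatKernel ν 0 (0:E3)) s' y) s = 0 := fun y => by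
    simp_rw [simKernel_backwardHeatKernel hν]
    exact deriv_const s _
  simp_rw [h0, abs_zero, integral_zero]
  refine mul_nonneg hM (setIntegral_nonneg measurableSet_Ioi fun τ _ => mul_nonneg
    (Real.exp_nonneg _) (integral_nonneg fun y => ?_))
  refine mul_nonneg (mul_nonneg (norm_nonneg _) (sq_nonneg _)) ?_
  rw [simKernel_backwardHeatKernel hν]
  exact (heatKernel_pos hν _).le

/-- The model kernel is covariant under EVERY parabolic screw motion `(c, R)`, `c > 0`,
`R` a linear isometry: `K(t,x) = c³ K(c²t, cRx)`. -/
theorem backwardHeatKernel_covariant {ν : ℝ} (hν : 0 < ν) {c : ℝ} (hc : 0 < c)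
    (R : E3 ≃ₗᵢ[ℝ] E3) {t : ℝ} (ht : t < 0) (x : E3) :
    backwardHeatKernel ν 0 (0:E3) t x = c ^ 3 * backwardHeatKernel ν 0 (0:E3) (c ^ 2 * t) (c • R x) := by
  have hct : c ^ 2 * t < 0 := mul_neg_of_pos_of_neg (pow_pos hc 2) ht
  have hs : 0 < -t := by linarith
  rw [backwardHeatKernel_eq hν.le (0:E3) ht, backwardHeatKernel_eq hν.le (0:E3) hct]
  simp only [finrank_euclideanSpace_fin, Nat.cast_ofNat, sub_zero, zero_sub]
  have h1 : ‖c • R x‖ ^ 2 = c ^ 2 * ‖x‖ ^ 2 := by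
    rw [norm_smul, LinearIsometryEquiv.norm_map, Real.norm_of_nonneg hc.le, mul_pow]
  have h2 : (-(c ^ 2 * t)) ^ (-(3:ℝ) / 2) = (c ^ 3)⁻¹ * (-t) ^ (-(3:ℝ) / 2) := by
    rw [show -(c ^ 2 * t) = c ^ 2 * (-t) by ring, Real.mul_rpow (by positivity) hs.le]
    congr 1
    rw [show (c ^ 2 : ℝ) = c ^ (2:ℝ) by norm_cast, ← Real.rpow_mul hc.le,
      show (2:ℝ) * (-(3:ℝ) / 2) = -(3:ℝ) by norm_num, Real.rpow_neg hc.le,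
      show (3:ℝ) = ((3:ℕ) : ℝ) by norm_num, Real.rpow_natCast]
  have h3 : -(c ^ 2 * ‖x‖ ^ 2) / (4 * ν * -(c ^ 2 * t)) = -‖x‖ ^ 2 / (4 * ν * -t) := by
    field_simp
  rw [h1, h2, h3]
  field_simp

/-- **The breathing swirl's kernel is SYMMETRY-COVARIANT** (for every `(c, R)`, whether or not
it is a symmetry of the flow). -/
theorem isSymmetryCovariant_breath {ν : ℝ} (hν : 0 < ν) :
    IsSymmetryCovariant (breath ν) (backwardHeatKernel ν 0 (0:E3)) :=
  fun _ R hc _ _ ht x => backwardHeatKernel_covariant hν hc R ht x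

/-! #### Scale-invariant first-order bounds of the breathing swirl -/

/-- Derivative of the breathing profile with the Fréchet derivatives of `V`, `V₂` displayed. -/
theorem hasFDerivAt_Wb' (ν t : ℝ) (y : E3) :
    HasFDerivAt (Wb ν t) (amp₁ ν t • fderiv ℝ V y + amp₂ ν t • fderiv ℝ V₂ y) y := by
  rw [(hasFDerivAt_V y).fderiv, (hasFDerivAt_V₂ y).fderiv]
  exact hasFDerivAt_Wb ν t y

/-- The time derivative of the breathing swirl at a point. -/
theorem hasDerivAt_breath (ν : ℝ) {t : ℝ} (ht : t < 0) (x : E3) :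
    HasDerivAt (fun s => breath ν s x)
      (sc t • (amp₁ ν t • fderiv ℝ V (sc t • x) ((sc t ^ 3 / 2) • x) +
          (Real.sqrt (∫ y, F₂ ν y) * (-Real.sin (Real.log (-t)) * t⁻¹)) • V (sc t • x) +
        (amp₂ ν t • fderiv ℝ V₂ (sc t • x) ((sc t ^ 3 / 2) • x) +
          (Real.sqrt (∫ y, F ν y) * (Real.cos (Real.log (-t)) * t⁻¹)) • V₂ (sc t • x))) +
        (sc t ^ 3 / 2) • Wb ν t (sc t • x)) t := by
  have hsc := hasDerivAt_sc ht
  have hlog := hasDerivAt_log_neg ht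
  have ha : HasDerivAt (amp₁ ν) (Real.sqrt (∫ y, F₂ ν y) * (-Real.sin (Real.log (-t)) * t⁻¹)) t :=
    hlog.cos.const_mul _
  have hb : HasDerivAt (amp₂ ν) (Real.sqrt (∫ y, F ν y) * (Real.cos (Real.log (-t)) * t⁻¹)) t :=
    hlog.sin.const_mul _
  have hy : HasDerivAt (fun s => sc s • x) ((sc t ^ 3 / 2) • x) t := hsc.smul_const x
  have hV : HasDerivAt (fun s => V (sc s • x)) (fderiv ℝ V (sc t • x) ((sc t ^ 3 / 2) • x)) t :=
    (hasFDerivAt_V _).differentiableAt.hasFDerivAt.comp_hasDerivAt t hy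
  have hV₂ : HasDerivAt (fun s => V₂ (sc s • x)) (fderiv ℝ V₂ (sc t • x) ((sc t ^ 3 / 2) • x)) t :=
    (hasFDerivAt_V₂ _).differentiableAt.hasFDerivAt.comp_hasDerivAt t hy
  exact hsc.smul ((ha.smul hV).add (hb.smul hV₂))

/-- **The breathing swirl obeys the scale-invariant first-order bounds** `‖∇v‖, ‖curl v‖ ≤ C′/(−t)`,
`‖∂ₜv‖ ≤ C′(−t)^{−3/2}` for some `C′ ≥ 0` (profiles smooth with compact support; amplitudes
and their `log`-time derivatives bounded). -/
theorem hasScaleInvariantBounds_breath (ν : ℝ) :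
    ∃ C' : ℝ, 0 ≤ C' ∧ HasScaleInvariantBounds C' (breath ν) := by
  -- global bounds on the profiles' derivatives (continuous with compact support)
  obtain ⟨B₁, hB₁⟩ := ((V_contDiff (n := 1)).continuous_fderiv one_ne_zero).bounded_above_of_compact_support
    (hasCompactSupport_V.fderiv ℝ)
  obtain ⟨B₂, hB₂⟩ := ((V₂_contDiff (n := 1)).continuous_fderiv one_ne_zero).bounded_above_of_compact_support
    (hasCompactSupport_V₂.fderiv ℝ)
  obtain ⟨K₁, hK₁⟩ := (continuous_curl (V_contDiff (n := 1))).bounded_above_of_compact_support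
    (hasCompactSupport_curl hasCompactSupport_V)
  obtain ⟨K₂, hK₂⟩ := (continuous_curl (V₂_contDiff (n := 1))).bounded_above_of_compact_support
    (hasCompactSupport_curl hasCompactSupport_V₂)
  have hg₁c : Continuous fun y : E3 => fderiv ℝ V y y :=
    ((V_contDiff (n := 1)).continuous_fderiv one_ne_zero).clm_apply continuous_id
  have hg₂c : Continuous fun y : E3 => fderiv ℝ V₂ y y :=
    ((V₂_contDiff (n := 1)).continuous_fderiv one_ne_zero).clm_apply continuous_id
  obtain ⟨G₁, hG₁⟩ := hg₁c.bounded_above_of_compact_support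
    ((hasCompactSupport_V.fderiv ℝ).mono fun y hy => by
      intro h; exact hy (by simp [h]))
  obtain ⟨G₂, hG₂⟩ := hg₂c.bounded_above_of_compact_support
    ((hasCompactSupport_V₂.fderiv ℝ).mono fun y hy => by
      intro h; exact hy (by simp [h]))
  have hB₁0 : 0 ≤ B₁ := (norm_nonneg _).trans (hB₁ 0)
  have hB₂0 : 0 ≤ B₂ := (norm_nonneg _).trans (hB₂ 0)
  have hK₁0 : 0 ≤ K₁ := (norm_nonneg _).trans (hK₁ 0)
  have hK₂0 : 0 ≤ K₂ := (norm_nonneg _).trans (hK₂ 0)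
  have hG₁0 : 0 ≤ G₁ := (norm_nonneg _).trans (hG₁ 0)
  have hG₂0 : 0 ≤ G₂ := (norm_nonneg _).trans (hG₂ 0)
  set a₀ : ℝ := Real.sqrt (∫ y, F₂ ν y) with ha₀
  set b₀ : ℝ := Real.sqrt (∫ y, F ν y) with hb₀
  have ha₀0 : 0 ≤ a₀ := Real.sqrt_nonneg _
  have hb₀0 : 0 ≤ b₀ := Real.sqrt_nonneg _
  -- the three constants
  set C₁ : ℝ := a₀ * B₁ + b₀ * B₂ with hC₁
  set C₂ : ℝ := a₀ * K₁ + b₀ * K₂ with hC₂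
  set C₃ : ℝ := a₀ * (G₁ / 2 + 2) + b₀ * (G₂ / 2 + 3) + (2 * a₀ + 3 * b₀) / 2 with hC₃
  have hC₁0 : 0 ≤ C₁ := by positivity
  have hC₂0 : 0 ≤ C₂ := by positivity
  have hC₃0 : 0 ≤ C₃ := by positivity
  refine ⟨C₁ + C₂ + C₃, by positivity, fun t ht x => ?_⟩
  have ht' : t < 0 := ht
  have hs : 0 < -t := by linarith
  have hsc := sc_pos hs
  have hsc0 : sc t ≠ 0 := hsc.ne'
  have hsc2 : sc t * sc t = (-t)⁻¹ := sc_mul_sc ht'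
  have ha : |amp₁ ν t| ≤ a₀ := abs_amp₁_le ν t
  have hb : |amp₂ ν t| ≤ b₀ := abs_amp₂_le ν t
  set y : E3 := sc t • x with hy
  refine ⟨?_, ?_, ?_⟩
  · -- velocity gradient
    have hD : fderiv ℝ (breath ν t) x = (sc t * sc t) • fderiv ℝ (Wb ν t) y :=
      (hasFDerivAt_smul_comp_smul (sc t) (hasFDerivAt_Wb' ν t (sc t • x))).fderiv.trans (by
        rw [(hasFDerivAt_Wb' ν t y).fderiv])
    have hW : ‖fderiv ℝ (Wb ν t) y‖ ≤ C₁ := by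
      rw [(hasFDerivAt_Wb' ν t y).fderiv]
      calc ‖amp₁ ν t • fderiv ℝ V y + amp₂ ν t • fderiv ℝ V₂ y‖
          ≤ ‖amp₁ ν t • fderiv ℝ V y‖ + ‖amp₂ ν t • fderiv ℝ V₂ y‖ := norm_add_le _ _
        _ = |amp₁ ν t| * ‖fderiv ℝ V y‖ + |amp₂ ν t| * ‖fderiv ℝ V₂ y‖ := by
            rw [norm_smul, norm_smul, Real.norm_eq_abs, Real.norm_eq_abs]
        _ ≤ a₀ * B₁ + b₀ * B₂ :=
            add_le_add (mul_le_mul ha (hB₁ y) (norm_nonneg _) ha₀0)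
              (mul_le_mul hb (hB₂ y) (norm_nonneg _) hb₀0)
    rw [hD, norm_smul, Real.norm_of_nonneg (mul_pos hsc hsc).le, hsc2, div_eq_mul_inv, mul_comm]
    exact mul_le_mul_of_nonneg_right (hW.trans (by linarith)) (inv_nonneg.2 hs.le)
  · -- vorticity
    have hW : ‖curl (Wb ν t) y‖ ≤ C₂ := by
      rw [curl_Wb]
      calc ‖amp₁ ν t • curl V y + amp₂ ν t • curl V₂ y‖
          ≤ ‖amp₁ ν t • curl V y‖ + ‖amp₂ ν t • curl V₂ y‖ := norm_add_le _ _
        _ = |amp₁ ν t| * ‖curl V y‖ + |amp₂ ν t| * ‖curl V₂ y‖ := by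
            rw [norm_smul, norm_smul, Real.norm_eq_abs, Real.norm_eq_abs]
        _ ≤ a₀ * K₁ + b₀ * K₂ :=
            add_le_add (mul_le_mul ha (hK₁ y) (norm_nonneg _) ha₀0)
              (mul_le_mul hb (hK₂ y) (norm_nonneg _) hb₀0)
    rw [curl_breath, norm_smul, Real.norm_of_nonneg (mul_pos hsc hsc).le, hsc2, div_eq_mul_inv,
      mul_comm]
    exact mul_le_mul_of_nonneg_right (hW.trans (by linarith)) (inv_nonneg.2 hs.le)
  · -- time derivative
    have hD := hasDerivAt_breath ν ht' x
    rw [timeDerivWithin_apply, derivWithin_of_mem_nhds (Iio_mem_nhds ht'), hD.deriv, ← sc_pow_three ht']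
    -- rewrite `x = sc⁻¹ y` inside the Fréchet derivatives
    have hx : x = (sc t)⁻¹ • y := by rw [hy, smul_smul, inv_mul_cancel₀ hsc.ne', one_smul]
    have hdV : fderiv ℝ V (sc t • x) ((sc t ^ 3 / 2) • x) = (sc t ^ 2 / 2) • fderiv ℝ V y y := by
      rw [← hy, map_smul, hx, map_smul, smul_smul]
      congr 1
      field_simp
    have hdV₂ : fderiv ℝ V₂ (sc t • x) ((sc t ^ 3 / 2) • x) = (sc t ^ 2 / 2) • fderiv ℝ V₂ y y := by
      rw [← hy, map_smul, hx, map_smul, smul_smul]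
      congr 1
      field_simp
    rw [hdV, hdV₂, ← hy]
    have hti : |t⁻¹| = sc t ^ 2 := by
      rw [abs_inv, abs_of_neg ht', sq, hsc2]
    -- term-by-term bounds
    have e1 : ‖amp₁ ν t • (sc t ^ 2 / 2) • fderiv ℝ V y y‖ ≤ a₀ * (sc t ^ 2 / 2) * G₁ := by
      rw [norm_smul, norm_smul, Real.norm_eq_abs, Real.norm_of_nonneg (by positivity)]
      calc |amp₁ ν t| * (sc t ^ 2 / 2 * ‖fderiv ℝ V y y‖) ≤ a₀ * (sc t ^ 2 / 2 * G₁) :=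
            mul_le_mul ha (mul_le_mul_of_nonneg_left (hG₁ y) (by positivity))
              (by positivity) ha₀0
        _ = a₀ * (sc t ^ 2 / 2) * G₁ := by ring
    have e2 : ‖(Real.sqrt (∫ y, F₂ ν y) * (-Real.sin (Real.log (-t)) * t⁻¹)) • V y‖ ≤
        a₀ * sc t ^ 2 * 2 := by
      rw [norm_smul, Real.norm_eq_abs, abs_mul, abs_mul, ← ha₀, abs_of_nonneg ha₀0, hti, abs_neg]
      calc a₀ * (|Real.sin (Real.log (-t))| * sc t ^ 2) * ‖V y‖ ≤ a₀ * (1 * sc t ^ 2) * 2 :=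
            mul_le_mul (mul_le_mul_of_nonneg_left
              (mul_le_mul_of_nonneg_right (Real.abs_sin_le_one _) (by positivity)) ha₀0)
              (norm_V_le y) (norm_nonneg _) (by positivity)
        _ = a₀ * sc t ^ 2 * 2 := by ring
    have e3 : ‖amp₂ ν t • (sc t ^ 2 / 2) • fderiv ℝ V₂ y y‖ ≤ b₀ * (sc t ^ 2 / 2) * G₂ := by
      rw [norm_smul, norm_smul, Real.norm_eq_abs, Real.norm_of_nonneg (by positivity)]
      calc |amp₂ ν t| * (sc t ^ 2 / 2 * ‖fderiv ℝ V₂ y y‖) ≤ b₀ * (sc t ^ 2 / 2 * G₂) :=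
            mul_le_mul hb (mul_le_mul_of_nonneg_left (hG₂ y) (by positivity))
              (by positivity) hb₀0
        _ = b₀ * (sc t ^ 2 / 2) * G₂ := by ring
    have e4 : ‖(Real.sqrt (∫ y, F ν y) * (Real.cos (Real.log (-t)) * t⁻¹)) • V₂ y‖ ≤
        b₀ * sc t ^ 2 * 3 := by
      rw [norm_smul, Real.norm_eq_abs, abs_mul, abs_mul, ← hb₀, abs_of_nonneg hb₀0, hti]
      calc b₀ * (|Real.cos (Real.log (-t))| * sc t ^ 2) * ‖V₂ y‖ ≤ b₀ * (1 * sc t ^ 2) * 3 :=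
            mul_le_mul (mul_le_mul_of_nonneg_left
              (mul_le_mul_of_nonneg_right (Real.abs_cos_le_one _) (by positivity)) hb₀0)
              (norm_V₂_le y) (norm_nonneg _) (by positivity)
        _ = b₀ * sc t ^ 2 * 3 := by ring
    have e5 : ‖(sc t ^ 3 / 2) • Wb ν t y‖ ≤ sc t ^ 3 / 2 * (2 * a₀ + 3 * b₀) := by
      rw [norm_smul, Real.norm_of_nonneg (by positivity)]
      refine mul_le_mul_of_nonneg_left ((norm_Wb_le ν t y).trans ?_) (by positivity)
      linarith
    calc ‖sc t • (amp₁ ν t • (sc t ^ 2 / 2) • fderiv ℝ V y y +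
              (Real.sqrt (∫ y, F₂ ν y) * (-Real.sin (Real.log (-t)) * t⁻¹)) • V y +
            (amp₂ ν t • (sc t ^ 2 / 2) • fderiv ℝ V₂ y y +
              (Real.sqrt (∫ y, F ν y) * (Real.cos (Real.log (-t)) * t⁻¹)) • V₂ y)) +
          (sc t ^ 3 / 2) • Wb ν t y‖
        ≤ sc t * ((a₀ * (sc t ^ 2 / 2) * G₁ + a₀ * sc t ^ 2 * 2) +
            (b₀ * (sc t ^ 2 / 2) * G₂ + b₀ * sc t ^ 2 * 3)) + sc t ^ 3 / 2 * (2 * a₀ + 3 * b₀) := by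
          refine (norm_add_le _ _).trans (add_le_add ?_ e5)
          rw [norm_smul, Real.norm_of_nonneg hsc.le]
          refine mul_le_mul_of_nonneg_left ((norm_add_le _ _).trans (add_le_add
            ((norm_add_le _ _).trans (add_le_add e1 e2))
            ((norm_add_le _ _).trans (add_le_add e3 e4)))) hsc.le
      _ = C₃ * sc t ^ 3 := by rw [hC₃]; ring
      _ ≤ (C₁ + C₂ + C₃) * sc t ^ 3 :=
          mul_le_mul_of_nonneg_right (by linarith) (pow_nonneg hsc.le 3)

/-- **(R3) KINEMATIC CANONICAL WITNESS.**  The breathing swirl and the backward heat kernel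
satisfy EVERY clause of the crux and of the normal form of line `kernel-fading-memory` except
the Navier–Stokes momentum equation (and the unproved kernel-uniqueness lever): smooth,
divergence-free, GLOBAL Type-I, kernel clauses, comparability, `H > 0` and `Λ ≡ 2` (indeed
`H = A₁A₂/t²` exactly), CENTRED, scale-invariant first-order bounds, kernel steady in
similarity variables, symmetry-covariant and slaved — and yet the field is NOT backward
self-similar and NOT a rotating wave.  All rigidity ("constant frequency ⇒ self-similar /
rotating wave") must therefore come from the dynamics. -/
theorem kinematic_canonical_witness {ν : ℝ} (hν : 0 < ν) :
    ∃ (C C' A : ℝ) (v : ℝ → E3 → E3) (K : ℝ → E3 → ℝ), 0 < A ∧ 0 ≤ C' ∧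
      IsSmoothSpaceTimeOn (Iio 0) v ∧ (∀ t ∈ Iio (0:ℝ), VectorCalculus.IsDivFree (v t)) ∧
      TypeIBound C v ∧ KernelClauses ν v K ∧ Comparable K ∧ FreqClause v K 2 ∧
      (∀ t ∈ Iio (0:ℝ), (∫ x, ‖curl (v t) x‖ ^ 2 * K t x) = A * (-t) ^ (-(2:ℝ))) ∧
      IsCentred v K ∧ HasScaleInvariantBounds C' v ∧
      (∀ s y, simKernel K s y = heatKernel ν y) ∧ IsSymmetryCovariant v K ∧
      (∀ κ M : ℝ, 0 ≤ M → IsSlaved κ M v K) ∧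
      ¬ IsBackwardSelfSimilar v ∧
      (∀ (α : ℝ) (U₀ : E3 → E3), ¬ ∀ t ∈ Iio (0:ℝ), ∀ x, v t x = pvAnsatz α (fun y _ => U₀ y) t x) := by
  obtain ⟨C', hC'0, hb⟩ := hasScaleInvariantBounds_breath ν
  refine ⟨Cb ν, C', (∫ y, F ν y) * (∫ y, F₂ ν y), breath ν, backwardHeatKernel ν 0 (0:E3),
    mul_pos (integral_F_pos hν) (integral_F₂_pos hν), hC'0, isSmoothSpaceTimeOn_breath ν,
    fun t _ => isDivFree_breath ν t, typeIBound_breath ν,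
    kernelClauses_backwardHeatKernel hν _ (fun t _ x => inner_self_breath ν t x),
    comparable_backwardHeatKernel hν, freqClause_breath hν, fun t ht => ?_, isCentred_breath ν, hb,
    simKernel_backwardHeatKernel hν, isSymmetryCovariant_breath hν,
    fun κ M hM => isSlaved_breath hν κ hM, breath_not_selfSimilar hν, breath_not_rotatingWave hν⟩
  rw [adaptedEnstrophy_breath hν (show t < 0 from ht), Real.rpow_neg (by linarith [show t < 0 from ht]),
    div_eq_mul_inv]
  congr 1
  rw [show (-t) ^ (2:ℝ) = (-t) ^ ((2:ℕ) : ℝ) by norm_num, Real.rpow_natCast]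
  ring

end Summit.NavierStokesRegularity.NavierStokesRegularity.Cruxes.FrequencyRigidity.Disproof
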